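import Literature.MathematicalPhysics.QuantumFieldTheory.Balaban1983to89.StrongCouplingDobrushinWindow
import Literature.MathematicalPhysics.QuantumFieldTheory.Balaban1983to89.CrossoverLedger
import Literature.MathematicalPhysics.QuantumLattice.RepLieAlgebraUnitary
import Literature.MathematicalPhysics.QuantumFieldTheory.PlaquetteWeightTorusDobrushin
import Literature.Probability.LatticeModels.GibbsSpecificationDLRProofs
import HarnessLib

/-!
# `Balaban1983to89.StrongCouplingTorusWindow` — the one-link Dobrushin–Vasserstein window of `SU(N)` lattice Yang–Mills
# run on the finite tori: volume-uniform clustering and the strong-coupling front `StrongCouplingFront` of the crossover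
# ledger, kernel level

**Observatory of the non-perturbative crossover; no mass-gap claim.**

statement-level skeleton of published theorems with citation tags; proofs where landed; nothing here is a claim about the Yang–Mills mass gap

Audit cell `pub-balaban`, build IR-3, seat `b2b-balaban-ir-sc-g3` (strong-coupling front, generation 3).  Value = KERNEL
THEOREMS with every hypothesis explicit: the named one-link hypothesis `OneLinkKRModulus N R K` of
`StrongCouplingDobrushinWindow` (a `Prop`; for `SU(2)` decided OFF kernel by certificate J-SC3, `ir/FRONT-SC.md` §3b — its
truth is never asserted here) implies the FINITE-VOLUME, VOLUME-UNIFORM clustering currency of the crossover ledger,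
`CrossoverLedger.ExponentialClustering` / `CrossoverLedger.StrongCouplingFront` (SC-b of `ir/UNITS.md`), i.e. the first
hypothesis of `CrossoverLedger.massGap_of_frontsMeet`.  Before this module that currency had no instantiated entry at all
(the sibling `StrongCouplingDobrushinWindow` delivers the infinite-volume DLR currency SC-a, `DLRMassGapAt`; the sibling
`StrongCouplingKPWindow` only names the schema `ExpClusteringOfKPCriterion` as a hypothesis).

THE THEOREMS (Dobrushin 1970 / Föllmer 1988 route, all lattice-side steps proved in the tree).  Fix `d ≥ 2`, `N ≥ 1` and the
TREE coupling `β` of the torus state `wilsonMeasure (fundamentalRep (Fin N)) β` on `(ℤ/L)^d` (plaquette weight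
`v_β(U_p) = exp(−β (N − Re tr U_p))`, `wilsonMeasure_eq_groupHeatKernelMeasure`; Wilson units `β_W = N β`, 't Hooft units
`β/N`; for `SU(2)` `β = β_W/2`, as in `StrongCouplingKPWindow`).  The one-link conditional law of the torus weight
specification at `e` is the tilted Haar measure `ν_B(dg) ∝ exp(N Re tr(g B)) dg` with `B = B_ω = (β/N) Σ_{p ∋ e}(staple)`
(`siteLaw_torusWilson_thooft`, torus twin of `siteLaw_ymSpecification_thooft`), `‖B_ω‖_op ≤ (|β|/N) 2(d−1)`
(`matrixOpNorm_tField_le`), `‖B_ω − B_η‖_F ≤ (|β|/N) n(e,y) ‖ω_y − η_y‖_F` (`frobNorm_tField_sub_le`), `Σ_y n(e,y) ≤ 6(d−1)`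
(`sum_tInfluence_le`); these need the four links of a torus plaquette to be distinct, i.e. `L ≥ 2`.  Hence
(`isKRContraction_torusWilson`) the modulus gives Dobrushin's condition in the Kantorovich–Rubinstein form of Föllmer 1988
Ch. I Remark (2.17) with constant `c = 6(d−1)(|β|/N) K` on EVERY torus of side `≥ 2`, with the same coefficients.
* `abs_integral_mul_sub_le_torusWilson` — Föllmer's covariance estimate (Ch. I Thm. (2.13), metric form) on the torus for
  BOUNDED MEASURABLE local observables: these are first smoothed by the specification kernels `γ_{Δf}`, `γ_{Δg}` of their
  supports (`specAvg`; the DLR equations `integral_specAvg`, `integral_specAvg_mul` leave the three integrals unchanged when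
  the plaquette closure of `Δf` misses `Δg`), and the smoothed observables are Lipschitz in every link with modulus
  `M (e^{4(d−1) ℓ D} − 1)/D`, `ℓ = |β|√N`, `D = 2√N` (`isLipBound_specAvg_torusWeightSpec`, the tilt oscillation bound of
  Georgii 2011 Prop. 8.8) and measurable inside the plaquette closures (`dependsOn_specAvg_torusWeightSpec`).
* `wilson_torusClustering_of_oneLinkKRModulus` — for `(|β|/N) 2(d−1) ≤ R`, `OneLinkKRModulus N R K`, `6(d−1)(|β|/N) K ≤ c < 1`
  and any two bounded measurable local observables `F₁, F₂` of `ℤ^d`, ONE constant `C` with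
  `|⟨F₁ · (F₂ ∘ θ_x)⟩_L − ⟨F₁⟩_L ⟨F₂ ∘ θ_x⟩_L| ≤ C e^{−m ‖x‖_∞}`, `m = −log max(c, 1/2)`, on every torus of side `L ≥ 2` and
  every displacement with `2‖x‖_∞ < L` (the proof skeleton is the tree's `plaquetteWeight_torusClustering_dobrushin`, whose
  total-variation threshold `|β| < log(5/3)/(8(d−1))` is replaced by the Kantorovich–Rubinstein modulus).
* `exponentialClustering_of_oneLinkKRModulus`, `strongCouplingFront_of_oneLinkKRModulus` (`d = 4`) — the crossover-ledger
  currency: `(β₀/N)·6 ≤ R`, `OneLinkKRModulus N R K`, `18 (β₀/N) K < 1` ⇒ `StrongCouplingFront (fundamentalLatticeRep N) β₀`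
  with the single rate `−log max(18 (β₀/N) K, 1/2)` for all `0 ≤ β ≤ β₀` (translation invariance of the torus state,
  `wilsonMeasure_map_torusConfigShift`, identifies `⟨B ∘ θ⟩ = ⟨B⟩` in `latticeConnectedCorr`).
* `su2_strongCouplingFront_of_oneLinkKRModulus` — THE `SU(2)` SCHEMA J-SC3 AS A FRONT (Wilson units):
  `0 ≤ K₂ → OneLinkKRModulusSU2 β₀W K₂ → 18 β₀W K₂ < 1 → StrongCouplingFront (fundamentalLatticeRep 2) (β₀W/2)`.
* `su2_strongCouplingFront_of_haarPoincare` — CONSISTENCY WITH S16: under the one-link Poincaré hypothesis `hLP` of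
  `oneLinkKRModulus_of_haarPoincare` (Bakry–Émery, Shen–Zhu–Zhu Lemma 4.1 / (4.4)), every `β₀W < 1/12` gives the same front —
  exactly Shen–Zhu–Zhu's window `|β| < 1/(16(d−1))` ('t Hooft units), now in the finite-volume currency.

CITATION HEADER (lean-in-tree rule).  (SZZ23) H. Shen, R. Zhu, X. Zhu, *A stochastic analysis approach to lattice Yang–Mills at
strong coupling*, CMP **400** (2023) 805–851, arXiv:2204.12737 — held (`paper:arxiv-2204.12737`; item numbers and pages below = the printed arXiv v1 PDF — the held TeX layer drops theorem heads, shows the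
LaTeX label `th:1.3` for Thm. 1.2, and its chunk numbers are not pages): Assumption 1.1 (p. 4), Thm. 1.2 [Uniqueness and ergodicity] (p. 5), the
UNNUMBERED REMARK after Rem. 1.3 (p. 6: uniqueness for small `β` «could possibly also be proven using the method of Dobrushin …
the related Wasserstein metric with respect to the Riemannian distance … has not been carried out in detail for lattice Yang
Mills in the literature»), Lemma 4.1 (p. 17), Cor. 1.6 [Mass gap] (p. 7; stated there for the infinite-volume state — the finite tori are
this module's business).  (Föl88) H. Föllmer, *Random fields and diffusion processes*, École d'Été de Saint-Flour XV–XVII, LNM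
**1362** (1988), Ch. I: (2.4) (Feller condition on `π_(k) f`), Thm. (2.13) (covariance estimate
`|cov_μ(f,g)| ≤ ¼ Σ δ_i(f) D_{ki} δ_k(g)`), Remark (2.17) (Vasserstein form) — held in *Mathematical Physics at Saint-Flour*
(Springer 2012), pp. 84–88 of the held text.  (Geo11) H.-O. Georgii, *Gibbs Measures and Phase Transitions*, 2nd ed., de
Gruyter (2011), Def. 1.23 (specification, `G(γ)`), Def. 2.9 (Gibbsian specification), Prop. 8.8 (oscillation of a tilt),
§8.2.  (Dob70) R. L. Dobrushin, Theory Probab. Appl. **15** (1970) 458–486, Thm. 4.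

DESIGN.  (i) The torus is treated as a finite "lattice" `Edge d L` carrying the torus weight specification `torusWeightSpec v_β`
of `PlaquetteWeightTorusSpecification` (for which `wilsonMeasure` IS a Gibbs measure, `isGibbsMeasure_groupHeatKernelMeasure`);
no infinite-volume object, periodisation or limit `L → ∞` enters.  (ii) Observables of the ledger are only bounded and
measurable (`LocalGaugeObservable`), while the Kantorovich–Rubinstein covariance bound `abs_covariance_le_of_isKRContraction`
wants Lipschitz observables; the bridge is the one-shot DLR smoothing of §4–§5, not a metric change (a discrete metric on the
supports would reinstate the total-variation threshold).  (iii) All constants are explicit and elementary; nothing is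
optimised (`C` depends on the supports, the bounds and `β`, never on `L` or `x`).

WHAT IS NOT CLAIMED.  No statement about the continuum, the mass gap, or any coupling beyond the hypotheses; the modulus
`OneLinkKRModulus` is a HYPOTHESIS (for `SU(2)` the off-kernel certificate J-SC3 of `ir/FRONT-SC.md` §3b reports
`18 · 0.192 · K̄ < 1` with two interval engines — analysis grade, not a tree theorem); `hLP` is a HYPOTHESIS (the tree's S16
pipeline takes the same one).  No constant of any manuscript under audit is used anywhere.
-/

open MeasureTheory Filter Topology ProbabilityTheory Function Finset
open scoped NNReal
open Literature.Probability.LatticeModels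
open Literature.Probability.LatticeModels.DobrushinMetric
open Literature.MathematicalPhysics.QuantumLattice (toTorusObservable
  IsCylinder IsLocalObservable LGConfig torusLift torusEdge groupHeatKernelMeasure
  groupHeatKernelMeasure_eq groupHeatKernelWeight fundamentalRep fundamentalLatticeRep
  fundamentalRep_apply continuous_fundamentalRep fundamentalRep_injective fundamentalRep_mem_unitaryGroup
)

namespace Literature.MathematicalPhysics.QuantumFieldTheory.Balaban1983to89.StrongCouplingTorusWindow

open Literature.MathematicalPhysics.QuantumFieldTheory
open Literature.MathematicalPhysics.QuantumFieldTheory.Balaban1983to89.StrongCouplingDobrushinWindow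

/-! ## §1 Torus staples: the plaquette action is affine in each link (torus twin of the `ℤ^d` staples of
`LatticeGaugeDobrushinPoincare`) -/

section TorusStaples

variable {d L : ℕ} {G : Type*} [Group G]

/-- First link `(x, i)` of the torus plaquette `q = (x, ⟨(i,j), i<j⟩)`. [folklore] -/
def tLink1 (q : Plaquette d L) : Edge d L := (q.1, q.2.1.1)

/-- Second link `(x + eᵢ, j)` of the torus plaquette. [folklore] -/
def tLink2 (q : Plaquette d L) : Edge d L := (q.1.shift q.2.1.1, q.2.1.2)

/-- Third link `(x + eⱼ, i)` of the torus plaquette (traversed backwards). [folklore] -/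
def tLink3 (q : Plaquette d L) : Edge d L := (q.1.shift q.2.1.2, q.2.1.1)

/-- Fourth link `(x, j)` of the torus plaquette (traversed backwards). [folklore] -/
def tLink4 (q : Plaquette d L) : Edge d L := (q.1, q.2.1.2)

/-- `plaqEdgesT` in terms of the four named links. [folklore] -/
theorem plaqEdgesT_eq (q : Plaquette d L) :
    plaqEdgesT q = {tLink1 q, tLink2 q, tLink3 q, tLink4 q} := rfl

/-- The torus plaquette holonomy as the ordered word in the four links. [folklore] -/
theorem plaquetteHolonomy_eq_links (U : GaugeConfig d L G) (q : Plaquette d L) :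
    plaquetteHolonomy U q.1 q.2.1.1 q.2.1.2 =
      U (tLink1 q) * U (tLink2 q) * (U (tLink3 q))⁻¹ * (U (tLink4 q))⁻¹ := rfl

/-- On a torus of side `L ≥ 2` a unit shift moves every site (same statement as the Summits-side
`RobustYangMillsRG.Negative.shift_ne_self`, which a Literature file cannot import). [folklore] -/
theorem shift_ne_self [NeZero L] (hL : 1 < L) (x : Site d L) (i : Fin d) : x.shift i ≠ x := by
  haveI : Fact (1 < L) := ⟨hL⟩
  intro h
  have h1 := congrFun h i
  simp [Site.shift] at h1

/-- The first two links of a plaquette differ (different directions). [folklore] -/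
theorem tLink1_ne_tLink2 (q : Plaquette d L) : tLink1 q ≠ tLink2 q :=
  fun h => (ne_of_lt q.2.2) (Prod.mk.inj h).2

/-- The first and third links of a plaquette differ on a torus of side `≥ 2` (different base points). [folklore] -/
theorem tLink1_ne_tLink3 [NeZero L] (hL : 1 < L) (q : Plaquette d L) : tLink1 q ≠ tLink3 q :=
  fun h => shift_ne_self hL q.1 q.2.1.2 (Prod.mk.inj h).1.symm

/-- The first and fourth links of a plaquette differ (different directions). [folklore] -/
theorem tLink1_ne_tLink4 (q : Plaquette d L) : tLink1 q ≠ tLink4 q :=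
  fun h => (ne_of_lt q.2.2) (Prod.mk.inj h).2

/-- The second and third links of a plaquette differ (different directions). [folklore] -/
theorem tLink2_ne_tLink3 (q : Plaquette d L) : tLink2 q ≠ tLink3 q :=
  fun h => (ne_of_lt q.2.2) (Prod.mk.inj h).2.symm

/-- The second and fourth links of a plaquette differ on a torus of side `≥ 2` (different base points). [folklore] -/
theorem tLink2_ne_tLink4 [NeZero L] (hL : 1 < L) (q : Plaquette d L) : tLink2 q ≠ tLink4 q :=
  fun h => shift_ne_self hL q.1 q.2.1.1 (Prod.mk.inj h).1

/-- The third and fourth links of a plaquette differ (different directions). [folklore] -/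
theorem tLink3_ne_tLink4 (q : Plaquette d L) : tLink3 q ≠ tLink4 q :=
  fun h => (ne_of_lt q.2.2) (Prod.mk.inj h).2

/-- The **torus staple** of the plaquette `q` at its link `e` in the configuration `ω`: the ordered product of the other
three link variables for which `Re tr ρ(U_q(ω^{e ← g})) = Re tr (ρ(g) ρ(staple))` (`re_trace_tholonomy_update`); junk if
`e ∉ q` (Shen–Zhu–Zhu CMP 400 (2023) §4.1; torus twin of `staple`). [folklore] -/
def tstaple (q : Plaquette d L) (e : Edge d L) (ω : GaugeConfig d L G) : G :=
  if e = tLink1 q then ω (tLink2 q) * (ω (tLink3 q))⁻¹ * (ω (tLink4 q))⁻¹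
  else if e = tLink2 q then (ω (tLink3 q))⁻¹ * (ω (tLink4 q))⁻¹ * ω (tLink1 q)
  else if e = tLink3 q then (ω (tLink2 q))⁻¹ * (ω (tLink1 q))⁻¹ * ω (tLink4 q)
  else ω (tLink3 q) * (ω (tLink2 q))⁻¹ * (ω (tLink1 q))⁻¹

/-- The three links read by `tstaple q e`, in order. [folklore] -/
def tstapleLinks (q : Plaquette d L) (e : Edge d L) : Fin 3 → Edge d L :=
  if e = tLink1 q then ![tLink2 q, tLink3 q, tLink4 q]
  else if e = tLink2 q then ![tLink3 q, tLink4 q, tLink1 q]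
  else if e = tLink3 q then ![tLink2 q, tLink1 q, tLink4 q]
  else ![tLink3 q, tLink2 q, tLink1 q]

/-- The torus staple is a `stapleWord` in its three links. [folklore] -/
theorem tstaple_eq_stapleWord [NeZero L] (hL : 1 < L) (q : Plaquette d L) (e : Edge d L)
    (ω : GaugeConfig d L G) :
    tstaple q e ω = stapleWord (decide (e = tLink1 q) || !decide (e = tLink2 q) &&
      !decide (e = tLink3 q)) (ω (tstapleLinks q e 0)) (ω (tstapleLinks q e 1))
      (ω (tstapleLinks q e 2)) := by
  unfold tstaple tstapleLinks stapleWord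
  by_cases h1 : e = tLink1 q
  · simp [h1]
  by_cases h2 : e = tLink2 q
  · subst h2
    simp [(tLink1_ne_tLink2 q).symm]
  by_cases h3 : e = tLink3 q
  · subst h3
    simp [(tLink1_ne_tLink3 hL q).symm, (tLink2_ne_tLink3 q).symm]
  · simp [h1, h2, h3]

section Unitary

variable {N : ℕ} (ρ : G →* Matrix (Fin N) (Fin N) ℂ)

/-- **The torus plaquette action is affine in each link**: for `e ∈ q` and side `L ≥ 2`,
`Re tr ρ(U_q(ω^{e ← g})) = Re tr(ρ(g) ρ(tstaple_q^e(ω)))` (torus twin of `re_trace_holonomy_update`;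
Shen–Zhu–Zhu CMP 400 (2023) §4.1). [folklore] -/
theorem re_trace_tholonomy_update [NeZero L] (hL : 1 < L)
    (hρu : ∀ g, ρ g ∈ Matrix.unitaryGroup (Fin N) ℂ)
    {q : Plaquette d L} {e : Edge d L} (he : e ∈ plaqEdgesT q) (ω : GaugeConfig d L G) (g : G) :
    (ρ (plaquetteHolonomy (Function.update ω e g) q.1 q.2.1.1 q.2.1.2)).trace.re =
      (ρ g * ρ (tstaple q e ω)).trace.re := by
  rw [plaquetteHolonomy_eq_links, ← map_mul]
  have h12 := tLink1_ne_tLink2 q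
  have h13 := tLink1_ne_tLink3 hL q
  have h14 := tLink1_ne_tLink4 q
  have h23 := tLink2_ne_tLink3 q
  have h24 := tLink2_ne_tLink4 hL q
  have h34 := tLink3_ne_tLink4 q
  rw [plaqEdgesT_eq] at he
  simp only [Finset.mem_insert, Finset.mem_singleton] at he
  unfold tstaple
  rcases he with rfl | rfl | rfl | rfl
  · simp only [if_true, Function.update_self, Function.update_of_ne h12.symm,
      Function.update_of_ne h13.symm, Function.update_of_ne h14.symm, mul_assoc]
  · simp only [if_neg h12.symm, if_true, Function.update_self, Function.update_of_ne h12,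
      Function.update_of_ne h23.symm, Function.update_of_ne h24.symm]
    rw [show ω (tLink1 q) * g * (ω (tLink3 q))⁻¹ * (ω (tLink4 q))⁻¹ =
      ω (tLink1 q) * (g * ((ω (tLink3 q))⁻¹ * (ω (tLink4 q))⁻¹)) by group,
      re_trace_map_mul_comm ρ]
    congr 3
    group
  · simp only [if_neg h13.symm, if_neg h23.symm, if_true, Function.update_self,
      Function.update_of_ne h13, Function.update_of_ne h23, Function.update_of_ne h34.symm]
    rw [← re_trace_map_inv ρ hρu]
    rw [show (ω (tLink1 q) * ω (tLink2 q) * g⁻¹ * (ω (tLink4 q))⁻¹)⁻¹ =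
      ω (tLink4 q) * (g * ((ω (tLink2 q))⁻¹ * (ω (tLink1 q))⁻¹)) by group,
      re_trace_map_mul_comm ρ]
    congr 3
    group
  · simp only [if_neg h14.symm, if_neg h24.symm, if_neg h34.symm, Function.update_self,
      Function.update_of_ne h14, Function.update_of_ne h24, Function.update_of_ne h34]
    rw [← re_trace_map_inv ρ hρu]
    congr 3
    group

end Unitary

end TorusStaples

/-! ## §2 `SU(N)`: the Wilson plaquette weight, the one-link law in 't Hooft form, influence counts -/

section SUN

variable {d L N : ℕ} [NeZero L]

/-- The torus staples are `1`-Lipschitz in each of their three links for the Frobenius distance. [folklore] -/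
theorem suFrobDist_tstaple_le (hL : 1 < L) (q : Plaquette d L) (e : Edge d L)
    (ω η : GaugeConfig d L (Matrix.specialUnitaryGroup (Fin N) ℂ)) :
    suFrobDist (tstaple q e ω) (tstaple q e η) ≤
      ∑ k : Fin 3, suFrobDist (ω (tstapleLinks q e k)) (η (tstapleLinks q e k)) := by
  rw [tstaple_eq_stapleWord hL, tstaple_eq_stapleWord hL, Fin.sum_univ_three]
  exact suFrobDist_stapleWord_le _ _ _ _ _ _ _

/-- The **torus influence count** `n(e, y)`: the number of (plaquette, position) pairs through which the link `y` enters
the one-link law at `e`; only `∑_y n(e, y) ≤ 6(d-1)` is used. [folklore] -/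
def tInfluence (e y : Edge d L) : ℕ :=
  ∑ q ∈ plaqsThrough e, ∑ k : Fin 3, if tstapleLinks q e k = y then 1 else 0

/-- **Row sums of the torus influence count**: `∑_{y ∈ linkNbrT e} n(e, y) ≤ 3 · #{q ∋ e} ≤ 6(d-1)`. [folklore] -/
theorem sum_tInfluence_le (e : Edge d L) : ∑ y ∈ linkNbrT e, tInfluence e y ≤ 6 * (d - 1) := by
  unfold tInfluence
  rw [Finset.sum_comm]
  calc ∑ q ∈ plaqsThrough e, ∑ y ∈ linkNbrT e, ∑ k : Fin 3, (if tstapleLinks q e k = y then 1 else 0)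
      ≤ ∑ _q ∈ plaqsThrough e, 3 := by
        refine Finset.sum_le_sum fun q _ => ?_
        rw [Finset.sum_comm]
        calc ∑ k : Fin 3, ∑ y ∈ linkNbrT e, (if tstapleLinks q e k = y then 1 else 0)
            ≤ ∑ _k : Fin 3, 1 := Finset.sum_le_sum fun k _ => by
              rw [Finset.sum_ite_eq]
              split_ifs <;> simp
          _ = 3 := by simp
    _ = 3 * (plaqsThrough e).card := by rw [Finset.sum_const, smul_eq_mul, mul_comm]
    _ ≤ 3 * (2 * (d - 1)) := Nat.mul_le_mul_left 3 (card_plaqsThrough_le e)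
    _ = 6 * (d - 1) := by ring

/-- The **torus staple sum** `S_ω = ∑_{q ∋ e} T_q^e(ω) ∈ M_N(ℂ)`. [folklore] -/
def tstapleSum (e : Edge d L) (ω : GaugeConfig d L (Matrix.specialUnitaryGroup (Fin N) ℂ)) :
    Matrix (Fin N) (Fin N) ℂ :=
  ∑ q ∈ plaqsThrough e, ((tstaple q e ω : Matrix.specialUnitaryGroup (Fin N) ℂ) : Matrix (Fin N) (Fin N) ℂ)

/-- `‖S_ω‖_op ≤ 2(d-1)` (each staple is unitary, at most `2(d-1)` plaquettes through a link). [folklore] -/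
theorem matrixOpNorm_tstapleSum_le [Nonempty (Fin N)] (hd : 1 ≤ d) (e : Edge d L)
    (ω : GaugeConfig d L (Matrix.specialUnitaryGroup (Fin N) ℂ)) :
    matrixOpNorm (tstapleSum e ω) ≤ 2 * ((d : ℝ) - 1) := by
  refine (matrixOpNorm_sum_le _ _).trans ?_
  rw [Finset.sum_congr rfl fun q _ => matrixOpNorm_of_mem_unitaryGroup (su_mem_unitaryGroup _),
    Finset.sum_const, nsmul_eq_mul, mul_one]
  calc ((plaqsThrough e).card : ℝ) ≤ ((2 * (d - 1) : ℕ) : ℝ) := by exact_mod_cast card_plaqsThrough_le e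
    _ = 2 * ((d : ℝ) - 1) := by push_cast [Nat.cast_sub hd]; ring

/-- **Lipschitz dependence of the torus staple sum on one link**: if `ω = η` off `y`, then
`‖S_ω − S_η‖_F ≤ n(e, y) ‖ω_y − η_y‖_F`. [folklore] -/
theorem frobNorm_tstapleSum_sub_le (hL : 1 < L) (e y : Edge d L)
    {ω η : GaugeConfig d L (Matrix.specialUnitaryGroup (Fin N) ℂ)} (hωη : ∀ z, z ≠ y → ω z = η z) :
    frobNorm (tstapleSum e ω - tstapleSum e η) ≤ tInfluence e y * suFrobDist (ω y) (η y) := by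
  rw [tstapleSum, tstapleSum, ← Finset.sum_sub_distrib]
  refine (frobNorm_sum_le _ _).trans ?_
  rw [tInfluence, Nat.cast_sum, Finset.sum_mul]
  refine Finset.sum_le_sum fun q _ => ?_
  refine (suFrobDist_tstaple_le hL q e ω η).trans ?_
  rw [Nat.cast_sum, Finset.sum_mul]
  refine Finset.sum_le_sum fun k _ => ?_
  by_cases hk : tstapleLinks q e k = y
  · rw [hk, if_pos rfl]
    simp
  · rw [hωη _ hk, suFrobDist_self, if_neg hk]
    simp

variable (N) in
/-- **The Wilson plaquette weight of `SU(N)` at tree coupling `β`**: `v_β(h) = exp(−β (N − Re tr h))`, so that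
`∏_q v_β(U_q) = exp(−β S_W(U))` with the tree's `wilsonAction (fundamentalRep (Fin N))`
(`wilsonMeasure_eq_groupHeatKernelMeasure`). [folklore] -/
noncomputable def wilsonPlaqWeight (β : ℝ) (h : Matrix.specialUnitaryGroup (Fin N) ℂ) : ℝ :=
  Real.exp (-(β * ((N : ℝ) - (h : Matrix (Fin N) (Fin N) ℂ).trace.re)))

/-- The Wilson plaquette weight is positive. [folklore] -/
theorem wilsonPlaqWeight_pos (β : ℝ) (h : Matrix.specialUnitaryGroup (Fin N) ℂ) : 0 < wilsonPlaqWeight N β h :=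
  Real.exp_pos _

/-- The Wilson plaquette weight is continuous on `SU(N)`. [folklore] -/
theorem continuous_wilsonPlaqWeight (β : ℝ) : Continuous (wilsonPlaqWeight N β) := by
  unfold wilsonPlaqWeight
  have h : Continuous fun g : Matrix.specialUnitaryGroup (Fin N) ℂ => (g : Matrix (Fin N) (Fin N) ℂ).trace.re :=
    Complex.continuous_re.comp (continuous_subtype_val.matrix_trace)
  fun_prop

/-- `log v_β(h) = −β (N − Re tr h)`. [folklore] -/
theorem log_wilsonPlaqWeight (β : ℝ) (h : Matrix.specialUnitaryGroup (Fin N) ℂ) :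
    Real.log (wilsonPlaqWeight N β h) = -(β * ((N : ℝ) - (h : Matrix (Fin N) (Fin N) ℂ).trace.re)) := by
  rw [wilsonPlaqWeight, Real.log_exp]

/-- **The torus Wilson measure of `SU(N)` is the plaquette-weight measure of `v_β`**: `wilsonMeasure (fundamentalRep) β =
groupHeatKernelMeasure (fun _ => v_β) 0` (both are `Z⁻¹ exp(−β S_W) ∏ dHaar`; `exp ∑ = ∏ exp`). [folklore] -/
theorem wilsonMeasure_eq_groupHeatKernelMeasure (β : ℝ) :
    wilsonMeasure (d := d) (L := L) (fundamentalRep (Fin N)) β =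
      groupHeatKernelMeasure (d := d) (L := L) (fun _ : ℝ => wilsonPlaqWeight N β) 0 := by
  have hw : ∀ U : GaugeConfig d L (Matrix.specialUnitaryGroup (Fin N) ℂ),
      groupHeatKernelWeight (d := d) (L := L) (fun _ : ℝ => wilsonPlaqWeight N β) 0 U =
        Real.exp (-β * wilsonAction (fundamentalRep (Fin N)) U) := by
    intro U
    simp only [groupHeatKernelWeight, wilsonPlaqWeight, wilsonAction, fundamentalRep_apply, neg_mul,
      Finset.mul_sum, Real.exp_sum]
  unfold wilsonMeasure partitionFunction wilsonWeight
  rw [groupHeatKernelMeasure_eq]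
  simp only [hw]

/-- The **torus link field** `B_ω = (β/N) S_ω` at tree coupling `β` ('t Hooft coupling `β/N`): the one-link law of the
torus Wilson measure at `e` is `∝ exp(N Re tr(g B_ω)) dg` (`siteLaw_torusWilson_thooft`). [folklore] -/
noncomputable def tField (β : ℝ) (e : Edge d L) (ω : GaugeConfig d L (Matrix.specialUnitaryGroup (Fin N) ℂ)) :
    Matrix (Fin N) (Fin N) ℂ :=
  ((β / N : ℝ) : ℂ) • tstapleSum e ω

/-- `‖B_ω‖_op ≤ (|β|/N) · 2(d−1)`. [folklore] -/
theorem matrixOpNorm_tField_le (hd : 1 ≤ d) (hN : 1 ≤ N) (β : ℝ) (e : Edge d L)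
    (ω : GaugeConfig d L (Matrix.specialUnitaryGroup (Fin N) ℂ)) :
    matrixOpNorm (tField β e ω) ≤ |β| / N * (2 * ((d : ℝ) - 1)) := by
  haveI : Nonempty (Fin N) := ⟨⟨0, hN⟩⟩
  rw [tField, matrixOpNorm_smul, Complex.norm_real, Real.norm_eq_abs, abs_div, Nat.abs_cast]
  exact mul_le_mul_of_nonneg_left (matrixOpNorm_tstapleSum_le hd e ω) (by positivity)

/-- `‖B_ω − B_η‖_F ≤ (|β|/N) n(e, y) ‖ω_y − η_y‖_F` when `ω = η` off `y`. [folklore] -/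
theorem frobNorm_tField_sub_le (hL : 1 < L) (β : ℝ) (e y : Edge d L)
    {ω η : GaugeConfig d L (Matrix.specialUnitaryGroup (Fin N) ℂ)} (hωη : ∀ z, z ≠ y → ω z = η z) :
    frobNorm (tField β e ω - tField β e η) ≤ |β| / N * tInfluence e y * suFrobDist (ω y) (η y) := by
  rw [tField, tField, ← smul_sub, frobNorm_smul, Complex.norm_real, Real.norm_eq_abs, abs_div, Nat.abs_cast,
    mul_assoc]
  exact mul_le_mul_of_nonneg_left (frobNorm_tstapleSum_sub_le hL e y hωη) (by positivity)

/-- **The local Wilson energy at a link in 't Hooft form**: for side `L ≥ 2`,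
`∑_{q ∋ e} log v_β(U_q(ω^{e←g})) = −β N #{q ∋ e} + N Re tr(g B_ω)`. [folklore] -/
theorem localLogWeight_update_eq (hL : 1 < L) (hN : 1 ≤ N) (β : ℝ) (e : Edge d L)
    (ω : GaugeConfig d L (Matrix.specialUnitaryGroup (Fin N) ℂ)) (g : Matrix.specialUnitaryGroup (Fin N) ℂ) :
    ∑ q ∈ plaqsThrough e, Real.log (wilsonPlaqWeight N β
        (plaquetteHolonomy (Function.update ω e g) q.1 q.2.1.1 q.2.1.2)) =
      -(β * N * (plaqsThrough e).card) +
        (N : ℝ) * ((g : Matrix (Fin N) (Fin N) ℂ) * tField β e ω).trace.re := by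
  have hN0 : (N : ℝ) ≠ 0 := by exact_mod_cast (show N ≠ 0 by omega)
  have hq : ∀ q ∈ plaqsThrough e, Real.log (wilsonPlaqWeight N β
      (plaquetteHolonomy (Function.update ω e g) q.1 q.2.1.1 q.2.1.2)) =
      -(β * N) + β * ((g : Matrix (Fin N) (Fin N) ℂ) *
        ((tstaple q e ω : Matrix.specialUnitaryGroup (Fin N) ℂ) : Matrix (Fin N) (Fin N) ℂ)).trace.re := by
    intro q hq
    rw [log_wilsonPlaqWeight]
    have h := re_trace_tholonomy_update (fundamentalRep (Fin N)) hL fundamentalRep_mem_unitaryGroup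
      (mem_plaqsThrough.1 hq) ω g
    simp only [fundamentalRep_apply] at h
    rw [h]
    ring
  rw [Finset.sum_congr rfl hq, Finset.sum_add_distrib, Finset.sum_const, nsmul_eq_mul, tField, tstapleSum,
    Matrix.mul_smul, Matrix.trace_smul, smul_eq_mul, Complex.re_ofReal_mul,
    Finset.mul_sum (plaqsThrough e) _ (g : Matrix (Fin N) (Fin N) ℂ), Matrix.trace_sum, Complex.re_sum,
    ← Finset.mul_sum]
  field_simp

/-- **The one-link conditional law of the torus Wilson measure in 't Hooft form**: for side `L ≥ 2` the law of `U_e`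
under the torus weight specification of `v_β` with boundary condition `ω` is the tilted Haar measure
`ν_{B_ω}(dg) ∝ exp(N Re tr(g B_ω)) dg` (Shen–Zhu–Zhu CMP 400 (2023) (1.1)–(1.2) at one link, on the torus).
[cite: arXiv220412737, (1.1)–(1.2)] -/
theorem siteLaw_torusWilson_thooft (hL : 1 < L) (hN : 1 ≤ N) (β : ℝ) (e : Edge d L)
    (ω : GaugeConfig d L (Matrix.specialUnitaryGroup (Fin N) ℂ)) :
    siteLaw (torusWeightSpec (d := d) (L := L) (wilsonPlaqWeight N β)) e ω =
      (haarProbability (Matrix.specialUnitaryGroup (Fin N) ℂ)).tilted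
        fun g => (N : ℝ) * ((g : Matrix (Fin N) (Fin N) ℂ) * tField β e ω).trace.re := by
  haveI : SecondCountableTopology (Matrix (Fin N) (Fin N) ℂ) :=
    inferInstanceAs (SecondCountableTopology (Fin N → Fin N → ℂ))
  haveI : SecondCountableTopology (Matrix.specialUnitaryGroup (Fin N) ℂ) :=
    Topology.IsEmbedding.subtypeVal.secondCountableTopology
  rw [siteLaw_torusWeightSpec_eq_tilted_local (continuous_wilsonPlaqWeight β) e ω]
  have : (fun g : Matrix.specialUnitaryGroup (Fin N) ℂ => ∑ q ∈ plaqsThrough e, Real.log (wilsonPlaqWeight N β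
      (plaquetteHolonomy (Function.update ω e g) q.1 q.2.1.1 q.2.1.2))) =
      fun g : Matrix.specialUnitaryGroup (Fin N) ℂ =>
        -(β * N * (plaqsThrough e).card) + (N : ℝ) * ((g : Matrix (Fin N) (Fin N) ℂ) * tField β e ω).trace.re :=
    funext (localLogWeight_update_eq hL hN β e ω)
  rw [this, tilted_const_add_eq]

/-- **One-link Lipschitz bound for the log of the Wilson plaquette weight**: if `U = U'` off the link `y ∈ q`, then
`|log v_β(U_q) − log v_β(U'_q)| ≤ |β| √N ‖U_y − U'_y‖_F` (the holonomy is `U_y · staple` with a common unitary staple).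
[folklore] -/
theorem abs_log_wilsonPlaqWeight_hol_sub_le (hL : 1 < L) (β : ℝ) (q : Plaquette d L) {y : Edge d L}
    (hy : y ∈ plaqEdgesT q) {U U' : GaugeConfig d L (Matrix.specialUnitaryGroup (Fin N) ℂ)}
    (hUU' : ∀ z, z ≠ y → U z = U' z) :
    |Real.log (wilsonPlaqWeight N β (plaquetteHolonomy U q.1 q.2.1.1 q.2.1.2)) -
        Real.log (wilsonPlaqWeight N β (plaquetteHolonomy U' q.1 q.2.1.1 q.2.1.2))| ≤
      |β| * Real.sqrt N * suFrobDist (U y) (U' y) := by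
  rw [log_wilsonPlaqWeight, log_wilsonPlaqWeight]
  have hU : U = Function.update U y (U y) := (Function.update_eq_self y U).symm
  have hU' : U' = Function.update U y (U' y) := by
    funext z
    by_cases hz : z = y
    · subst hz; simp
    · rw [Function.update_of_ne hz, hUU' z hz]
  have h1 := re_trace_tholonomy_update (fundamentalRep (Fin N)) hL fundamentalRep_mem_unitaryGroup hy U (U y)
  have h2 := re_trace_tholonomy_update (fundamentalRep (Fin N)) hL fundamentalRep_mem_unitaryGroup hy U (U' y)
  rw [← hU] at h1
  rw [← hU'] at h2
  simp only [fundamentalRep_apply] at h1 h2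
  rw [h1, h2]
  have key := abs_re_trace_su_mul_sub_le (U y) (U' y)
    ((tstaple q y U : Matrix.specialUnitaryGroup (Fin N) ℂ) : Matrix (Fin N) (Fin N) ℂ)
  rw [frobNorm_su] at key
  rw [show -(β * ((N : ℝ) - ((U y : Matrix (Fin N) (Fin N) ℂ) *
        ((tstaple q y U : Matrix.specialUnitaryGroup (Fin N) ℂ) : Matrix (Fin N) (Fin N) ℂ)).trace.re)) -
      -(β * ((N : ℝ) - ((U' y : Matrix (Fin N) (Fin N) ℂ) *
        ((tstaple q y U : Matrix.specialUnitaryGroup (Fin N) ℂ) : Matrix (Fin N) (Fin N) ℂ)).trace.re)) =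
      β * (((U y : Matrix (Fin N) (Fin N) ℂ) *
        ((tstaple q y U : Matrix.specialUnitaryGroup (Fin N) ℂ) : Matrix (Fin N) (Fin N) ℂ)).trace.re -
        ((U' y : Matrix (Fin N) (Fin N) ℂ) *
        ((tstaple q y U : Matrix.specialUnitaryGroup (Fin N) ℂ) : Matrix (Fin N) (Fin N) ℂ)).trace.re) by ring,
    abs_mul, mul_assoc]
  exact mul_le_mul_of_nonneg_left (by rw [mul_comm]; exact key) (abs_nonneg β)

end SUN


/-! ## §3 Dobrushin's condition in the Kantorovich–Rubinstein form for the torus Wilson specification -/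

section Contraction

variable {d L N : ℕ} [NeZero L]

/-- **The one-link modulus gives Dobrushin's condition on every torus of side `≥ 2`**: with `‖B_ω‖_op ≤ R`
(`matrixOpNorm_tField_le`) and `‖B_ω − B_η‖_F ≤ (|β|/N) n(e,y) ‖ω_y − η_y‖_F` (`frobNorm_tField_sub_le`), the modulus
`OneLinkKRModulus N R K` makes the torus weight specification of `v_β` a Kantorovich–Rubinstein contraction for the Frobenius
distance over the plaquette neighbours with coefficients `C(e,y) = K (|β|/N) n(e,y)` (Shen–Zhu–Zhu CMP 400 (2023), remark
after Rem. 1.3 (p. 6), run on the torus; Föllmer 1988 Ch. I (2.7) in the metric form of Remark (2.17)).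
[cite: arXiv220412737, unnumbered remark p. 6 (after Rem. 1.3; Dobrushin route)] [cite: Follmer1988, Ch. I Remark (2.17)] -/
theorem isKRContraction_torusWilson (hd : 1 ≤ d) (hN : 1 ≤ N) (hL : 1 < L) {β R K : ℝ} (hK : 0 ≤ K)
    (hR : |β| / N * (2 * ((d : ℝ) - 1)) ≤ R) (hmod : OneLinkKRModulus N R K) :
    IsKRContraction (torusWeightSpec (d := d) (L := L) (wilsonPlaqWeight N β)) suFrobDist linkNbrT
      fun e y => K * (|β| / N) * (tInfluence e y : ℝ) := by
  haveI : SecondCountableTopology (Matrix (Fin N) (Fin N) ℂ) :=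
    inferInstanceAs (SecondCountableTopology (Fin N → Fin N → ℂ))
  haveI : SecondCountableTopology (Matrix.specialUnitaryGroup (Fin N) ℂ) :=
    Topology.IsEmbedding.subtypeVal.secondCountableTopology
  refine ⟨not_mem_linkNbrT, fun e y => by positivity,
    fun e η η' h => siteLaw_torusWeightSpec_congr (continuous_wilsonPlaqWeight β) e h,
    fun e y _ ω η hωη φ L' hφm hφb hL' hφL => ?_⟩
  rw [siteLaw_torusWilson_thooft hL hN β e ω, siteLaw_torusWilson_thooft hL hN β e η]
  have hBω := (matrixOpNorm_tField_le hd hN β e ω).trans hR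
  have hBη := (matrixOpNorm_tField_le hd hN β e η).trans hR
  refine (hmod _ _ hBω hBη φ L' hφm hφb hL' hφL).trans ?_
  calc K * L' * frobNorm (tField β e ω - tField β e η)
      ≤ K * L' * (|β| / N * tInfluence e y * suFrobDist (ω y) (η y)) :=
        mul_le_mul_of_nonneg_left (frobNorm_tField_sub_le hL β e y hωη) (mul_nonneg hK hL')
    _ = K * (|β| / N) * tInfluence e y * L' * suFrobDist (ω y) (η y) := by ring

/-- **Row sums of the torus Dobrushin coefficients**: `∑_{y ∈ nbr e} K (|β|/N) n(e,y) ≤ 6(d−1) (|β|/N) K`. [folklore] -/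
theorem sum_linkNbrT_wilsonCoeff_le (hd : 1 ≤ d) {β K : ℝ} (hK : 0 ≤ K) (e : Edge d L) :
    ∑ y ∈ linkNbrT e, K * (|β| / N) * (tInfluence e y : ℝ) ≤ 6 * ((d : ℝ) - 1) * (|β| / N) * K := by
  rw [← Finset.mul_sum]
  have hsum : ∑ y ∈ linkNbrT e, (tInfluence e y : ℝ) ≤ 6 * ((d : ℝ) - 1) := by
    calc ∑ y ∈ linkNbrT e, (tInfluence e y : ℝ) = ((∑ y ∈ linkNbrT e, tInfluence e y : ℕ) : ℝ) := by
          push_cast; rfl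
      _ ≤ ((6 * (d - 1) : ℕ) : ℝ) := by exact_mod_cast sum_tInfluence_le e
      _ = 6 * ((d : ℝ) - 1) := by push_cast [Nat.cast_sub hd]; ring
  calc K * (|β| / N) * ∑ y ∈ linkNbrT e, (tInfluence e y : ℝ) ≤ K * (|β| / N) * (6 * ((d : ℝ) - 1)) :=
        mul_le_mul_of_nonneg_left hsum (by positivity)
    _ = 6 * ((d : ℝ) - 1) * (|β| / N) * K := by ring

end Contraction

/-! ## §4 DLR smoothing of bounded measurable observables (generic specification) -/

section Smoothing

variable {V S : Type*} [MeasurableSpace S] {γ : Specification V S}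

/-- **The DLR smoothing** `γ_Λ f (η) = ∫ f dγ_Λ(· | η)` of an observable by the specification kernel of the finite volume
`Λ` (the kernel `γ_Λ` applied to a function, Georgii 2011 Def. 1.23; for `Λ = {k}` this is Föllmer's `π_(k) f` of
Ch. I (2.4), the tree's `siteAvg`). [cite: Georgii2011, Def. 1.23] -/
noncomputable def specAvg (γ : Specification V S) (Λ : Finset V) (f : (V → S) → ℝ) (η : V → S) : ℝ :=
  ∫ σ, f σ ∂(γ Λ η)

/-- `γ_Λ f` is measurable for measurable `f`. [folklore] -/
theorem measurable_specAvg (hγ : IsSpecification γ) (Λ : Finset V) {f : (V → S) → ℝ} (hf : Measurable f) :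
    Measurable (specAvg γ Λ f) := by
  let κ : Kernel (V → S) (V → S) := ⟨γ Λ, hγ.measurable_fun Λ⟩
  exact (hf.stronglyMeasurable.integral_kernel (κ := κ)).measurable

/-- `|γ_Λ f| ≤ M` if `|f| ≤ M`. [folklore] -/
theorem abs_specAvg_le (hγ : IsSpecification γ) (Λ : Finset V) {f : (V → S) → ℝ} {M : ℝ}
    (hM : ∀ σ, |f σ| ≤ M) (η : V → S) : |specAvg γ Λ f η| ≤ M := by
  haveI := hγ.isProbability Λ η
  have h := norm_integral_le_of_norm_le_const (μ := γ Λ η) (f := f) (C := M)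
    (ae_of_all _ fun σ => by rw [Real.norm_eq_abs]; exact hM σ)
  simpa [specAvg] using h

/-- A product of bounded functions is bounded. [folklore] -/
theorem abs_mul_le_of_abs_le {α : Type*} {f g : α → ℝ} {Mf Mg : ℝ} (hMf : ∀ σ, |f σ| ≤ Mf)
    (hMg : ∀ σ, |g σ| ≤ Mg) (σ : α) : |f σ * g σ| ≤ Mf * Mg := by
  rw [abs_mul]
  exact mul_le_mul (hMf σ) (hMg σ) (abs_nonneg _) ((abs_nonneg _).trans (hMf σ))

/-- **DLR equation for the smoothing**: `μ(γ_Λ f) = μ(f)` for a Gibbs measure `μ`. [cite: Georgii2011, Def. 1.23] -/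
theorem integral_specAvg (hγ : IsSpecification γ) {μ : Measure (V → S)} (hμ : IsGibbsMeasure γ μ)
    (Λ : Finset V) {f : (V → S) → ℝ} (hfm : Measurable f) {M : ℝ} (hM : ∀ σ, |f σ| ≤ M) :
    ∫ η, specAvg γ Λ f η ∂μ = ∫ σ, f σ ∂μ := by
  haveI := hμ.isProbabilityMeasure
  exact hμ.integral_integral_eq hγ Λ (integrable_of_abs_le' hfm hM)

/-- **Smoothing against an observable blind to `Λ`**: if `g` depends only on coordinates outside `Λ`, then
`μ((γ_Λ f) g) = μ(f g)` (properness: `g` is `γ_Λ(· | η)`-a.s. equal to `g(η)`; then the DLR equation for `f g`).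
[cite: Georgii2011, Def. 1.23] -/
theorem integral_specAvg_mul (hγ : IsSpecification γ) {μ : Measure (V → S)} (hμ : IsGibbsMeasure γ μ)
    (Λ : Finset V) {f g : (V → S) → ℝ} (hfm : Measurable f) {Mf : ℝ} (hMf : ∀ σ, |f σ| ≤ Mf)
    (hgm : Measurable g) {Mg : ℝ} (hMg : ∀ σ, |g σ| ≤ Mg) {T : Set V} (hg : DependsOn g T)
    (hT : ∀ x ∈ Λ, x ∉ T) :
    ∫ η, specAvg γ Λ f η * g η ∂μ = ∫ σ, f σ * g σ ∂μ := by
  haveI := hμ.isProbabilityMeasure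
  have hpt : ∀ η, specAvg γ Λ f η * g η = ∫ σ, f σ * g σ ∂(γ Λ η) := fun η => by
    rw [specAvg, ← integral_mul_const]
    refine integral_congr_ae ?_
    filter_upwards [hγ.proper Λ η] with σ hσ
    rw [hg fun i hi => hσ i fun hiΛ => hT i hiΛ hi]
  simp_rw [hpt]
  exact hμ.integral_integral_eq hγ Λ (integrable_of_abs_le' (hfm.mul hgm) (abs_mul_le_of_abs_le hMf hMg))

end Smoothing

/-! ## §5 Smoothing by the torus weight specification: locality and Lipschitz bounds -/

section TorusSmoothing

variable {d L : ℕ} [NeZero L] {G : Type*} [Group G] [TopologicalSpace G] [IsTopologicalGroup G]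
  [CompactSpace G] [MeasurableSpace G] [BorelSpace G] [SecondCountableTopology G]

/-- **The smoothing as a tilted product-Haar integral**: `γ_Λ f (η) = ∫ f(ζ η_{Λᶜ}) μ_η(dζ)` with
`μ_η = Haar^{⊗Λ}.tilted (W ∘ (ζ ↦ ζ η_{Λᶜ}))`, `W = ∑_q log v(U_q)` (change of variables `map_tilted_comp`).
[cite: Georgii2011, Def. 2.9] -/
theorem specAvg_torusWeightSpec_eq {v : G → ℝ} (hv : Continuous v) (Λ : Finset (Edge d L))
    {f : GaugeConfig d L G → ℝ} (hfm : Measurable f) (η : GaugeConfig d L G) :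
    specAvg (torusWeightSpec v) Λ f η =
      ∫ ζ, f (glueWith Λ ζ η) ∂((Measure.pi fun _ : ↥Λ => haarProbability G).tilted
        fun ζ => torusLogWeight v (glueWith Λ ζ η)) := by
  unfold specAvg torusWeightSpec
  rw [← map_tilted_comp _ (measurable_glueWith Λ η) (measurable_torusLogWeight hv),
    integral_map (measurable_glueWith Λ η).aemeasurable hfm.aestronglyMeasurable]
  rfl

omit [TopologicalSpace G] [IsTopologicalGroup G] [CompactSpace G] [MeasurableSpace G] [BorelSpace G]
  [SecondCountableTopology G] [NeZero L] in
/-- Gluing the same inside data onto two outside configurations that agree on the edges of `q` off `Λ` gives the same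
holonomy around `q`. [folklore] -/
theorem plaquetteHolonomy_glueWith_congr (Λ : Finset (Edge d L)) (q : Plaquette d L) (ζ : ↥Λ → G)
    {σ τ : GaugeConfig d L G} (h : ∀ z ∈ plaqEdgesT q, z ∉ Λ → σ z = τ z) :
    plaquetteHolonomy (glueWith Λ ζ σ) q.1 q.2.1.1 q.2.1.2 =
      plaquetteHolonomy (glueWith Λ ζ τ) q.1 q.2.1.1 q.2.1.2 := by
  refine dependsOn_plaquetteHolonomy q fun z hz => ?_
  by_cases hzΛ : z ∈ Λ
  · rw [glueWith_apply_mem _ _ _ hzΛ, glueWith_apply_mem _ _ _ hzΛ]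
  · rw [glueWith_apply_not_mem _ _ _ hzΛ, glueWith_apply_not_mem _ _ _ hzΛ, h z hz hzΛ]

/-- The **plaquette closure** of a link set `Λ`: `Λ` together with every link of every plaquette through a link of `Λ`
(the dependence set of `γ_Λ f` for `f` measurable inside `Λ`). [folklore] -/
def plaqClosure (Λ : Finset (Edge d L)) : Finset (Edge d L) :=
  Λ ∪ Λ.biUnion fun e => (plaqsThrough e).biUnion plaqEdgesT

/-- `Λ ⊆ plaqClosure Λ`. [folklore] -/
theorem subset_plaqClosure (Λ : Finset (Edge d L)) : Λ ⊆ plaqClosure Λ :=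
  Finset.subset_union_left

/-- Every link of a plaquette through a link of `Λ` lies in the plaquette closure of `Λ`. [folklore] -/
theorem mem_plaqClosure_of_mem_plaqEdgesT {Λ : Finset (Edge d L)} {q : Plaquette d L} {e z : Edge d L}
    (he : e ∈ Λ) (heq : e ∈ plaqEdgesT q) (hz : z ∈ plaqEdgesT q) : z ∈ plaqClosure Λ :=
  Finset.mem_union_right _ (Finset.mem_biUnion.2 ⟨e, he, Finset.mem_biUnion.2 ⟨q, mem_plaqsThrough.2 heq, hz⟩⟩)

/-- Every link of the plaquette closure is within periodic sup-distance `1` of `Λ`. [folklore] -/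
theorem exists_near_of_mem_plaqClosure {Λ : Finset (Edge d L)} {y : Edge d L} (hy : y ∈ plaqClosure Λ) :
    ∃ y₀ ∈ Λ, torusNorm (y.1 - y₀.1) ≤ 1 := by
  rcases Finset.mem_union.1 hy with h | h
  · exact ⟨y, h, by rw [sub_self, torusNorm_zero]; exact zero_le_one⟩
  · obtain ⟨e, he, h2⟩ := Finset.mem_biUnion.1 h
    obtain ⟨q, hq, hyq⟩ := Finset.mem_biUnion.1 h2
    exact ⟨e, he, torusNorm_sub_le_one_of_mem_plaqEdgesT hyq (mem_plaqsThrough.1 hq)⟩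

/-- `#(plaqClosure Λ) ≤ #Λ · (1 + 8(d−1))`. [folklore] -/
theorem card_plaqClosure_le (Λ : Finset (Edge d L)) : (plaqClosure Λ).card ≤ Λ.card * (1 + 4 * (2 * (d - 1))) := by
  unfold plaqClosure
  have hin : ∀ e ∈ Λ, ((plaqsThrough e).biUnion plaqEdgesT).card ≤ 4 * (2 * (d - 1)) := fun e _ =>
    calc ((plaqsThrough e).biUnion plaqEdgesT).card ≤ ∑ q ∈ plaqsThrough e, (plaqEdgesT q).card :=
          Finset.card_biUnion_le
      _ ≤ ∑ _q ∈ plaqsThrough e, 4 := Finset.sum_le_sum fun q _ => card_plaqEdgesT_le q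
      _ = 4 * (plaqsThrough e).card := by rw [Finset.sum_const, smul_eq_mul, mul_comm]
      _ ≤ 4 * (2 * (d - 1)) := Nat.mul_le_mul_left 4 (card_plaqsThrough_le e)
  calc (Λ ∪ Λ.biUnion fun e => (plaqsThrough e).biUnion plaqEdgesT).card
      ≤ Λ.card + (Λ.biUnion fun e => (plaqsThrough e).biUnion plaqEdgesT).card := Finset.card_union_le _ _
    _ ≤ Λ.card + ∑ e ∈ Λ, ((plaqsThrough e).biUnion plaqEdgesT).card :=
        Nat.add_le_add_left Finset.card_biUnion_le _
    _ ≤ Λ.card + ∑ _e ∈ Λ, 4 * (2 * (d - 1)) := Nat.add_le_add_left (Finset.sum_le_sum hin) _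
    _ = Λ.card * (1 + 4 * (2 * (d - 1))) := by rw [Finset.sum_const, smul_eq_mul]; ring

omit [TopologicalSpace G] [IsTopologicalGroup G] [CompactSpace G] [MeasurableSpace G] [BorelSpace G]
  [SecondCountableTopology G] in
/-- **Quasilocality of the energy shift**: if two outside configurations agree on the plaquette closure of `Λ`, the torus
energies of the glued configurations differ by a constant independent of the inside data (the plaquettes meeting `Λ` see
the same links; the others do not see the inside). [folklore] -/
theorem exists_torusLogWeight_glueWith_eq_add (v : G → ℝ) (Λ : Finset (Edge d L)) {σ τ : GaugeConfig d L G}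
    (h : ∀ z ∈ plaqClosure Λ, σ z = τ z) :
    ∃ κ : ℝ, ∀ ζ : ↥Λ → G, torusLogWeight v (glueWith Λ ζ σ) = κ + torusLogWeight v (glueWith Λ ζ τ) := by
  classical
  refine ⟨∑ q : Plaquette d L, if Disjoint (plaqEdgesT q) Λ then
      Real.log (v (plaquetteHolonomy σ q.1 q.2.1.1 q.2.1.2)) - Real.log (v (plaquetteHolonomy τ q.1 q.2.1.1 q.2.1.2))
    else 0, fun ζ => ?_⟩
  unfold torusLogWeight
  rw [← Finset.sum_add_distrib]
  refine Finset.sum_congr rfl fun q _ => ?_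
  by_cases hq : Disjoint (plaqEdgesT q) Λ
  · rw [if_pos hq]
    have h1 : ∀ ρ' : GaugeConfig d L G, plaquetteHolonomy (glueWith Λ ζ ρ') q.1 q.2.1.1 q.2.1.2 =
        plaquetteHolonomy ρ' q.1 q.2.1.1 q.2.1.2 := fun ρ' =>
      dependsOn_plaquetteHolonomy q fun z hz => glueWith_apply_not_mem _ _ _ (Finset.disjoint_left.1 hq hz)
    rw [h1 σ, h1 τ]
    ring
  · rw [if_neg hq, zero_add]
    obtain ⟨e, heq, heΛ⟩ := Finset.not_disjoint_iff.1 hq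
    rw [plaquetteHolonomy_glueWith_congr Λ q ζ fun z hz _ => h z (mem_plaqClosure_of_mem_plaqEdgesT heΛ heq hz)]

omit [TopologicalSpace G] [IsTopologicalGroup G] [CompactSpace G] [MeasurableSpace G] [BorelSpace G]
  [SecondCountableTopology G] in
/-- **One-link Lipschitz bound for the glued energy**: if the weight `log v(U_q)` is `ℓ`-Lipschitz in each link of `q` for the
distance `r`, `y ∉ Λ` and `σ = τ` off `y`, then `|W(ζ σ_{Λᶜ}) − W(ζ τ_{Λᶜ})| ≤ 2(d−1) ℓ r(σ_y, τ_y)` for every inside datum `ζ`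
(only the `≤ 2(d−1)` plaquettes through `y` change). [folklore] -/
theorem abs_torusLogWeight_glueWith_sub_le {v : G → ℝ} {r : G → G → ℝ} {ℓ : ℝ} (hℓ : 0 ≤ ℓ)
    (hr : ∀ a b, 0 ≤ r a b)
    (hvLip : ∀ (q : Plaquette d L) (y : Edge d L), y ∈ plaqEdgesT q → ∀ U U' : GaugeConfig d L G,
      (∀ z, z ≠ y → U z = U' z) →
      |Real.log (v (plaquetteHolonomy U q.1 q.2.1.1 q.2.1.2)) -
          Real.log (v (plaquetteHolonomy U' q.1 q.2.1.1 q.2.1.2))| ≤ ℓ * r (U y) (U' y))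
    (Λ : Finset (Edge d L)) {y : Edge d L} (hy : y ∉ Λ) {σ τ : GaugeConfig d L G}
    (hστ : ∀ z, z ≠ y → σ z = τ z) (ζ : ↥Λ → G) :
    |torusLogWeight v (glueWith Λ ζ σ) - torusLogWeight v (glueWith Λ ζ τ)| ≤
      ((2 * (d - 1) : ℕ) : ℝ) * (ℓ * r (σ y) (τ y)) := by
  classical
  have hagree : ∀ z, z ≠ y → glueWith Λ ζ σ z = glueWith Λ ζ τ z := fun z hz => by
    by_cases hzΛ : z ∈ Λ
    · rw [glueWith_apply_mem _ _ _ hzΛ, glueWith_apply_mem _ _ _ hzΛ]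
    · rw [glueWith_apply_not_mem _ _ _ hzΛ, glueWith_apply_not_mem _ _ _ hzΛ, hστ z hz]
  have hσy : glueWith Λ ζ σ y = σ y := glueWith_apply_not_mem _ _ _ hy
  have hτy : glueWith Λ ζ τ y = τ y := glueWith_apply_not_mem _ _ _ hy
  unfold torusLogWeight
  rw [← Finset.sum_sub_distrib]
  refine (Finset.abs_sum_le_sum_abs _ _).trans ?_
  have hterm : ∀ q ∈ (Finset.univ : Finset (Plaquette d L)),
      |Real.log (v (plaquetteHolonomy (glueWith Λ ζ σ) q.1 q.2.1.1 q.2.1.2)) -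
          Real.log (v (plaquetteHolonomy (glueWith Λ ζ τ) q.1 q.2.1.1 q.2.1.2))| ≤
        if y ∈ plaqEdgesT q then ℓ * r (σ y) (τ y) else 0 := by
    intro q _
    split_ifs with hyq
    · have h := hvLip q y hyq _ _ hagree
      rwa [hσy, hτy] at h
    · have hh : plaquetteHolonomy (glueWith Λ ζ σ) q.1 q.2.1.1 q.2.1.2 =
          plaquetteHolonomy (glueWith Λ ζ τ) q.1 q.2.1.1 q.2.1.2 :=
        dependsOn_plaquetteHolonomy q fun z hz => hagree z (by rintro rfl; exact hyq hz)
      rw [hh, sub_self, abs_zero]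
  refine (Finset.sum_le_sum hterm).trans ?_
  rw [← Finset.sum_filter, Finset.sum_const, nsmul_eq_mul]
  have hps : (Finset.univ.filter fun q : Plaquette d L => y ∈ plaqEdgesT q) = plaqsThrough y := rfl
  rw [hps]
  have hcard : ((plaqsThrough y).card : ℝ) ≤ ((2 * (d - 1) : ℕ) : ℝ) := by exact_mod_cast card_plaqsThrough_le y
  exact mul_le_mul_of_nonneg_right hcard (mul_nonneg hℓ (hr _ _))

/-- **The smoothing of an observable measurable inside `Λ` depends only on the plaquette closure of `Λ`.** [folklore] -/
theorem dependsOn_specAvg_torusWeightSpec {v : G → ℝ} (hv : Continuous v) (Λ : Finset (Edge d L))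
    {f : GaugeConfig d L G → ℝ} (hfm : Measurable f) (hfdep : DependsOn f (↑Λ : Set (Edge d L))) :
    DependsOn (specAvg (torusWeightSpec v) Λ f) (↑(plaqClosure Λ) : Set (Edge d L)) := by
  intro σ τ h
  obtain ⟨κ, hκ⟩ := exists_torusLogWeight_glueWith_eq_add v Λ (σ := σ) (τ := τ) fun z hz => h z hz
  rw [specAvg_torusWeightSpec_eq hv Λ hfm σ, specAvg_torusWeightSpec_eq hv Λ hfm τ]
  have hint : ∀ ζ : ↥Λ → G, f (glueWith Λ ζ σ) = f (glueWith Λ ζ τ) := fun ζ => hfdep fun z hz => by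
    rw [glueWith_apply_mem _ _ _ hz, glueWith_apply_mem _ _ _ hz]
  simp_rw [hint, hκ]
  rw [tilted_const_add_eq]

/-- **The smoothing is Lipschitz in every outside link** (Georgii 2011, Prop. 8.8: oscillation of a tilt; here in the metric
form): if `log v(U_q)` is `ℓ`-Lipschitz in each link of `q` for a distance `r ≤ D`, then for `f` measurable inside `Λ` with
`|f| ≤ M`, `|γ_Λ f(σ) − γ_Λ f(τ)| ≤ M (e^{4(d−1)ℓ D} − 1)/D · r(σ_y, τ_y)` whenever `σ = τ` off `y` (for `y ∈ Λ` the left side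
vanishes). [cite: Georgii2011, Prop. 8.8] -/
theorem isLipBound_specAvg_torusWeightSpec {v : G → ℝ} (hv : Continuous v) (hv0 : ∀ g, 0 < v g)
    {r : G → G → ℝ} (hr0 : ∀ a b, 0 ≤ r a b) {D : ℝ} (hD : 0 < D) (hrD : ∀ a b, r a b ≤ D) {ℓ : ℝ} (hℓ : 0 ≤ ℓ)
    (hvLip : ∀ (q : Plaquette d L) (y : Edge d L), y ∈ plaqEdgesT q → ∀ U U' : GaugeConfig d L G,
      (∀ z, z ≠ y → U z = U' z) →
      |Real.log (v (plaquetteHolonomy U q.1 q.2.1.1 q.2.1.2)) -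
          Real.log (v (plaquetteHolonomy U' q.1 q.2.1.1 q.2.1.2))| ≤ ℓ * r (U y) (U' y))
    (Λ : Finset (Edge d L)) {f : GaugeConfig d L G → ℝ} (hfm : Measurable f)
    (hfdep : DependsOn f (↑Λ : Set (Edge d L))) {M : ℝ} (hM : ∀ σ, |f σ| ≤ M) :
    IsLipBound r (specAvg (torusWeightSpec v) Λ f)
      fun _ => M * ((Real.exp (D * (2 * (((2 * (d - 1) : ℕ) : ℝ) * ℓ))) - 1) / D) := by
  have hM0 : 0 ≤ M := (abs_nonneg _).trans (hM fun _ => 1)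
  set a : ℝ := 2 * (((2 * (d - 1) : ℕ) : ℝ) * ℓ) with ha
  have ha0 : 0 ≤ a := by positivity
  have hE0 : 0 ≤ (Real.exp (D * a) - 1) / D :=
    div_nonneg (sub_nonneg.2 (Real.one_le_exp (by positivity))) hD.le
  refine ⟨fun _ => mul_nonneg hM0 hE0, fun y σ τ hστ => ?_⟩
  by_cases hy : y ∈ Λ
  · have hglue : ∀ ζ : ↥Λ → G, glueWith Λ ζ σ = glueWith Λ ζ τ := fun ζ => funext fun z => by
      by_cases hzΛ : z ∈ Λ
      · rw [glueWith_apply_mem _ _ _ hzΛ, glueWith_apply_mem _ _ _ hzΛ]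
      · rw [glueWith_apply_not_mem _ _ _ hzΛ, glueWith_apply_not_mem _ _ _ hzΛ,
          hστ z (by rintro rfl; exact hzΛ hy)]
    rw [specAvg_torusWeightSpec_eq hv Λ hfm σ, specAvg_torusWeightSpec_eq hv Λ hfm τ]
    simp_rw [hglue]
    rw [sub_self, abs_zero]
    exact mul_nonneg (mul_nonneg hM0 hE0) (hr0 _ _)
  · rw [specAvg_torusWeightSpec_eq hv Λ hfm σ, specAvg_torusWeightSpec_eq hv Λ hfm τ]
    have hint : ∀ ζ : ↥Λ → G, f (glueWith Λ ζ τ) = f (glueWith Λ ζ σ) := fun ζ => hfdep fun z hz => by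
      rw [glueWith_apply_mem _ _ _ hz, glueWith_apply_mem _ _ _ hz]
    simp_rw [hint]
    have h1m : Measurable fun ζ : ↥Λ → G => torusLogWeight v (glueWith Λ ζ σ) :=
      (measurable_torusLogWeight hv).comp (measurable_glueWith Λ σ)
    have h2m : Measurable fun ζ : ↥Λ → G => torusLogWeight v (glueWith Λ ζ τ) :=
      (measurable_torusLogWeight hv).comp (measurable_glueWith Λ τ)
    obtain ⟨B, hB⟩ := exists_abs_torusLogWeight_le (d := d) (L := L) hv hv0
    have hφm : Measurable fun ζ : ↥Λ → G => f (glueWith Λ ζ σ) := hfm.comp (measurable_glueWith Λ σ)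
    have hφL : ∀ a' b' : ↥Λ → G, |f (glueWith Λ a' σ) - f (glueWith Λ b' σ)| ≤ 2 * M := fun a' b' =>
      calc |f (glueWith Λ a' σ) - f (glueWith Λ b' σ)| ≤ |f (glueWith Λ a' σ)| + |f (glueWith Λ b' σ)| := abs_sub _ _
        _ ≤ M + M := add_le_add (hM _) (hM _)
        _ = 2 * M := by ring
    have key := abs_integral_tilted_sub_integral_tilted_le (Measure.pi fun _ : ↥Λ => haarProbability G) h1m h2m
      ⟨B, fun ζ => hB _⟩ ⟨B, fun ζ => hB _⟩ (κ := 0) (ε := ((2 * (d - 1) : ℕ) : ℝ) * (ℓ * r (σ y) (τ y)))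
      (fun ζ => by rw [sub_zero]; exact abs_torusLogWeight_glueWith_sub_le hℓ hr0 hvLip Λ hy hστ ζ) hφm
      ⟨M, fun ζ => hM _⟩ hφL
    refine key.trans ?_
    have hconv := exp_mul_sub_one_le_div_mul (k := r (σ y) (τ y)) (K := D) (t := a) (hr0 _ _) (hrD _ _) hD ha0
    have e1 : 2 * (((2 * (d - 1) : ℕ) : ℝ) * (ℓ * r (σ y) (τ y))) = r (σ y) (τ y) * a := by rw [ha]; ring
    rw [e1]
    calc (Real.exp (r (σ y) (τ y) * a) - 1) / 2 * (2 * M) = M * (Real.exp (r (σ y) (τ y) * a) - 1) := by ring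
      _ ≤ M * (r (σ y) (τ y) / D * (Real.exp (D * a) - 1)) := mul_le_mul_of_nonneg_left hconv hM0
      _ = M * ((Real.exp (D * a) - 1) / D) * r (σ y) (τ y) := by ring

end TorusSmoothing

/-! ## §6 Covariance decay on the torus for `SU(N)` Wilson in the Kantorovich–Rubinstein regime -/

section Covariance

variable {d L N : ℕ} [NeZero L]

/-- The **smoothing Lipschitz factor** `E = (e^{4(d−1) ℓ D} − 1)/D` of `isLipBound_specAvg_torusWeightSpec` for the Wilson
weight of `SU(N)` at tree coupling `β`: `ℓ = |β| √N` (`abs_log_wilsonPlaqWeight_hol_sub_le`), `D = 2√N` (`suFrobDist_le`). [folklore] -/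
noncomputable def wilsonSmoothLip (N d : ℕ) (β : ℝ) : ℝ :=
  (Real.exp (2 * Real.sqrt N * (2 * (((2 * (d - 1) : ℕ) : ℝ) * (|β| * Real.sqrt N)))) - 1) / (2 * Real.sqrt N)

/-- The smoothing Lipschitz factor is non-negative. [folklore] -/
theorem wilsonSmoothLip_nonneg (hN : 1 ≤ N) (d : ℕ) (β : ℝ) : 0 ≤ wilsonSmoothLip N d β := by
  unfold wilsonSmoothLip
  have hN0 : (0 : ℝ) < N := by exact_mod_cast (show 0 < N by omega)
  exact div_nonneg (sub_nonneg.2 (Real.one_le_exp (by positivity))) (by positivity)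

/-- `|∫ f dμ| ≤ M` for `|f| ≤ M` and a probability measure. [folklore] -/
theorem abs_integral_le_of_abs_le {α : Type*} [MeasurableSpace α] {μ : Measure α} [IsProbabilityMeasure μ]
    {f : α → ℝ} {M : ℝ} (hM : ∀ x, |f x| ≤ M) : |∫ x, f x ∂μ| ≤ M := by
  have h := norm_integral_le_of_norm_le_const (μ := μ) (f := f) (C := M)
    (ae_of_all _ fun x => by rw [Real.norm_eq_abs]; exact hM x)
  simpa using h

/-- **Covariance bound on the torus by DLR smoothing** (Föllmer 1988 Ch. I Thm. (2.13) with Remark (2.17), Künsch 1982,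
Georgii 2011 §8.2, on the torus weight specification; bounded measurable observables are first smoothed by `γ_{Δf}`,
`γ_{Δg}` — DLR equations and properness — into Lipschitz ones): for `SU(N)` Wilson at tree coupling `β` with one-link
modulus `OneLinkKRModulus N R K`, `‖B_ω‖_op ≤ R` and Dobrushin constant `6(d−1)(|β|/N) K ≤ c ≤ 1`, bounded measurable
`f, g` depending on link sets `Δf, Δg` with `plaqClosure Δf` disjoint from `Δg`, and a profile `ℓ` vanishing on
`plaqClosure Δg` and `1`-Lipschitz along plaquette neighbours,
`|μ(fg) − μ(f)μ(g)| ≤ 2 (2√N)² (#plaqClosure Δg · M_g E) ∑_{y ∈ plaqClosure Δf} c^{ℓ y} M_f E`.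
[cite: Follmer1988, Ch. I Theorem (2.13)] [cite: Georgii2011, Thm. 8.7, Thm. 8.20, Remark 8.26, §8.2] -/
theorem abs_integral_mul_sub_le_torusWilson (hd : 2 ≤ d) (hN : 1 ≤ N) (hL : 1 < L) {β R K c : ℝ} (hK : 0 ≤ K)
    (hR : |β| / N * (2 * ((d : ℝ) - 1)) ≤ R) (hmod : OneLinkKRModulus N R K)
    (hc : 6 * ((d : ℝ) - 1) * (|β| / N) * K ≤ c) (hc1 : c ≤ 1)
    {f g : GaugeConfig d L (Matrix.specialUnitaryGroup (Fin N) ℂ) → ℝ} (hfm : Measurable f)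
    {Δf : Finset (Edge d L)} (hfdep : DependsOn f (↑Δf : Set (Edge d L))) {Mf : ℝ} (hMf : ∀ σ, |f σ| ≤ Mf)
    (hgm : Measurable g) {Δg : Finset (Edge d L)} (hgdep : DependsOn g (↑Δg : Set (Edge d L))) {Mg : ℝ}
    (hMg : ∀ σ, |g σ| ≤ Mg) (hsep : ∀ y ∈ plaqClosure Δf, y ∉ Δg) (ℓ : Edge d L → ℕ)
    (hℓ0 : ∀ y ∈ plaqClosure Δg, ℓ y = 0) (hℓ : ∀ x ∉ plaqClosure Δg, ∀ y ∈ linkNbrT x, ℓ x ≤ ℓ y + 1) :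
    |(∫ σ, f σ * g σ ∂(wilsonMeasure (d := d) (L := L) (fundamentalRep (Fin N)) β)) -
        (∫ σ, f σ ∂(wilsonMeasure (d := d) (L := L) (fundamentalRep (Fin N)) β)) *
          ∫ σ, g σ ∂(wilsonMeasure (d := d) (L := L) (fundamentalRep (Fin N)) β)| ≤
      2 * (2 * Real.sqrt N) ^ 2 * (∑ _y ∈ plaqClosure Δg, Mg * wilsonSmoothLip N d β) *
        ∑ y ∈ plaqClosure Δf, c ^ ℓ y * (Mf * wilsonSmoothLip N d β) := by
  classical
  haveI : SecondCountableTopology (Matrix (Fin N) (Fin N) ℂ) :=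
    inferInstanceAs (SecondCountableTopology (Fin N → Fin N → ℂ))
  haveI : SecondCountableTopology (Matrix.specialUnitaryGroup (Fin N) ℂ) :=
    Topology.IsEmbedding.subtypeVal.secondCountableTopology
  set μ := wilsonMeasure (d := d) (L := L) (fundamentalRep (Fin N)) β with hμdef
  have hv := continuous_wilsonPlaqWeight (N := N) β
  have hv0 := wilsonPlaqWeight_pos (N := N) β
  have hμv : μ = groupHeatKernelMeasure (d := d) (L := L) (fun _ : ℝ => wilsonPlaqWeight N β) 0 :=
    wilsonMeasure_eq_groupHeatKernelMeasure β
  have hγ := isSpecification_torusWeightSpec (d := d) (L := L) hv hv0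
  have hG : IsGibbsMeasure (torusWeightSpec (d := d) (L := L) (wilsonPlaqWeight N β)) μ := by
    rw [hμv]; exact isGibbsMeasure_groupHeatKernelMeasure hv hv0
  haveI : IsProbabilityMeasure μ := hG.isProbabilityMeasure
  have hd1 : 1 ≤ d := by omega
  have hN0 : (0 : ℝ) < N := by exact_mod_cast (show 0 < N by omega)
  have hKR := isKRContraction_torusWilson (L := L) hd1 hN hL hK hR hmod
  have hd1' : (0 : ℝ) ≤ (d : ℝ) - 1 := by
    have : (1 : ℝ) ≤ d := by exact_mod_cast hd1
    linarith
  have hc0 : 0 ≤ c :=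
    le_trans (mul_nonneg (mul_nonneg (mul_nonneg (by norm_num) hd1') (by positivity)) hK) hc
  have hrow : ∀ e : Edge d L, ∑ y ∈ linkNbrT e, K * (|β| / N) * (tInfluence e y : ℝ) ≤ c := fun e =>
    (sum_linkNbrT_wilsonCoeff_le hd1 hK e).trans hc
  -- the smoothed observables
  set fb := specAvg (torusWeightSpec (d := d) (L := L) (wilsonPlaqWeight N β)) Δf f with hfb
  set gb := specAvg (torusWeightSpec (d := d) (L := L) (wilsonPlaqWeight N β)) Δg g with hgb
  have hfbm : Measurable fb := measurable_specAvg hγ Δf hfm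
  have hgbm : Measurable gb := measurable_specAvg hγ Δg hgm
  have hfbM : ∀ σ, |fb σ| ≤ Mf := abs_specAvg_le hγ Δf hMf
  have hgbM : ∀ σ, |gb σ| ≤ Mg := abs_specAvg_le hγ Δg hMg
  have hfbdep : DependsOn fb (↑(plaqClosure Δf) : Set (Edge d L)) :=
    dependsOn_specAvg_torusWeightSpec hv Δf hfm hfdep
  have hgbdep : DependsOn gb (↑(plaqClosure Δg) : Set (Edge d L)) :=
    dependsOn_specAvg_torusWeightSpec hv Δg hgm hgdep
  have hvLip : ∀ (q : Plaquette d L) (y : Edge d L), y ∈ plaqEdgesT q →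
      ∀ U U' : GaugeConfig d L (Matrix.specialUnitaryGroup (Fin N) ℂ), (∀ z, z ≠ y → U z = U' z) →
      |Real.log (wilsonPlaqWeight N β (plaquetteHolonomy U q.1 q.2.1.1 q.2.1.2)) -
          Real.log (wilsonPlaqWeight N β (plaquetteHolonomy U' q.1 q.2.1.1 q.2.1.2))| ≤
        |β| * Real.sqrt N * suFrobDist (U y) (U' y) :=
    fun q y hy U U' hUU' => abs_log_wilsonPlaqWeight_hol_sub_le hL β q hy hUU'
  have hD : (0 : ℝ) < 2 * Real.sqrt N := by positivity
  have hfbLip : IsLipBound suFrobDist fb fun _ => Mf * wilsonSmoothLip N d β :=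
    isLipBound_specAvg_torusWeightSpec hv hv0 suFrobDist_nonneg hD suFrobDist_le (by positivity) hvLip Δf hfm
      hfdep hMf
  have hgbLip : IsLipBound suFrobDist gb fun _ => Mg * wilsonSmoothLip N d β :=
    isLipBound_specAvg_torusWeightSpec hv hv0 suFrobDist_nonneg hD suFrobDist_le (by positivity) hvLip Δg hgm
      hgdep hMg
  -- DLR identities: smoothing does not change the three integrals
  have h1 : ∫ σ, f σ * g σ ∂μ = ∫ σ, fb σ * gb σ ∂μ := by
    have ha : ∫ η, fb η * g η ∂μ = ∫ σ, f σ * g σ ∂μ :=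
      integral_specAvg_mul hγ hG Δf hfm hMf hgm hMg hgdep fun x hx => hsep x (subset_plaqClosure Δf hx)
    have hb : ∫ η, gb η * fb η ∂μ = ∫ σ, g σ * fb σ ∂μ :=
      integral_specAvg_mul hγ hG Δg hgm hMg hfbm hfbM hfbdep fun x hx hx' => hsep x hx' hx
    rw [← ha]
    have hb' : ∫ η, fb η * gb η ∂μ = ∫ σ, fb σ * g σ ∂μ := by
      simp_rw [mul_comm (fb _)]
      exact hb
    exact hb'.symm
  have h2 : ∫ σ, f σ ∂μ = ∫ σ, fb σ ∂μ := (integral_specAvg hγ hG Δf hfm hMf).symm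
  have h3 : ∫ σ, g σ ∂μ = ∫ σ, gb σ ∂μ := (integral_specAvg hγ hG Δg hgm hMg).symm
  rw [h1, h2, h3]
  have key := abs_covariance_le_of_isKRContraction hγ hKR (r := suFrobDist) (R := 2 * Real.sqrt N)
    suFrobDist_nonneg suFrobDist_le hD.le hc0 hc1 hrow hG hfbm hfbdep hfbM hfbLip hgbm hgbdep hgbM hgbLip ℓ hℓ0 hℓ
  have hcov : cov[fb, gb; μ] = (∫ σ, fb σ * gb σ ∂μ) - (∫ σ, fb σ ∂μ) * ∫ σ, gb σ ∂μ := by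
    rw [covariance_eq_sub]
    · rfl
    · exact memLp_of_bounded (a := -Mf) (b := Mf) (ae_of_all _ fun σ => abs_le.1 (hfbM σ))
        hfbm.aestronglyMeasurable 2
    · exact memLp_of_bounded (a := -Mg) (b := Mg) (ae_of_all _ fun σ => abs_le.1 (hgbM σ))
        hgbm.aestronglyMeasurable 2
  rw [hcov] at key
  exact key

end Covariance

/-! ## §7 Volume-uniform exponential clustering of local observables -/

section Clustering

variable {d N : ℕ}

/-- The **Kantorovich–Rubinstein rate** `m(c) = −log max(c, 1/2)` of a Dobrushin constant `c < 1`. [folklore] -/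
noncomputable def krRate (c : ℝ) : ℝ := -Real.log (max c (1 / 2))

/-- The Kantorovich–Rubinstein rate of a Dobrushin constant `c < 1` is positive. [folklore] -/
theorem krRate_pos {c : ℝ} (hc1 : c < 1) : 0 < krRate c :=
  neg_pos.2 (Real.log_neg (lt_max_of_lt_right (by norm_num)) (max_lt hc1 (by norm_num)))

/-- **Exponential clustering of `SU(N)` Wilson torus states in the Kantorovich–Rubinstein regime, uniformly in the volume
and in the displacement** (Dobrushin 1970 Thm. 4 / Föllmer 1988 Ch. I Thm. (2.13) with Remark (2.17) / Georgii 2011 §8.2,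
run on the torus weight specification; the one-link input is the modulus `OneLinkKRModulus N R K` of
`StrongCouplingDobrushinWindow`, cf. Shen–Zhu–Zhu CMP 400 (2023), unnumbered remark p. 6 after Rem. 1.3 and Cor. 1.6 "Mass gap"): if
`(|β|/N) 2(d−1) ≤ R` and `6(d−1)(|β|/N) K ≤ c < 1` then with `m = −log max(c, 1/2) > 0`, for all bounded measurable local
observables `F₁, F₂` of `ℤ^d` ONE constant `C` bounds
`|⟨F₁ · (F₂ ∘ θ_x)⟩_L − ⟨F₁⟩_L ⟨F₂ ∘ θ_x⟩_L| ≤ C e^{−m ‖x‖_∞}` under `wilsonMeasure (fundamentalRep (Fin N)) β` on every torus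
of side `L ≥ 2` and every displacement with `2‖x‖_∞ < L`.  Every hypothesis explicit; the modulus is decided off kernel.
[cite: Follmer1988, Ch. I Theorem (2.13)] [cite: Georgii2011, Thm. 8.7, Thm. 8.20, Remark 8.26, §8.2]
[cite: arXiv220412737, unnumbered remark p. 6 (after Rem. 1.3; Dobrushin route) with Thm. 1.2 (Uniqueness and ergodicity) and Cor. 1.6 (Mass gap)] -/
theorem wilson_torusClustering_of_oneLinkKRModulus (hd : 2 ≤ d) (hN : 1 ≤ N) {β R K c : ℝ} (hK : 0 ≤ K)
    (hR : |β| / N * (2 * ((d : ℝ) - 1)) ≤ R) (hmod : OneLinkKRModulus N R K)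
    (hc : 6 * ((d : ℝ) - 1) * (|β| / N) * K ≤ c) (hc1 : c < 1)
    (F₁ F₂ : LGConfig d (Matrix.specialUnitaryGroup (Fin N) ℂ) → ℝ)
    (h₁ : IsLocalObservable F₁) (h₂ : IsLocalObservable F₂) (h₁m : Measurable F₁) (h₂m : Measurable F₂)
    (hb₁ : ∃ C, ∀ U, |F₁ U| ≤ C) (hb₂ : ∃ C, ∀ U, |F₂ U| ≤ C) :
    ∃ C : ℝ, ∀ (L : ℕ) [NeZero L], 2 ≤ L → ∀ x : Literature.Probability.LatticeModels.Site d,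
      2 * ‖x‖ < (L : ℝ) →
      |(∫ V, toTorusObservable L (fun U => F₁ U * F₂ (QuantumLattice.configShift x U)) V
            ∂(wilsonMeasure (d := d) (L := L) (fundamentalRep (Fin N)) β)) -
          (∫ V, toTorusObservable L F₁ V ∂(wilsonMeasure (d := d) (L := L) (fundamentalRep (Fin N)) β)) *
            ∫ V, toTorusObservable L (F₂ ∘ QuantumLattice.configShift x) V
              ∂(wilsonMeasure (d := d) (L := L) (fundamentalRep (Fin N)) β)| ≤
        C * Real.exp (-krRate c * ‖x‖) := by
  classical
  obtain ⟨Λ₁, hΛ₁⟩ := h₁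
  obtain ⟨Λ₂, hΛ₂⟩ := h₂
  obtain ⟨M₁, hM₁⟩ := hb₁
  obtain ⟨M₂, hM₂⟩ := hb₂
  -- the Dobrushin constant actually used and the mass
  set c' : ℝ := max c (1 / 2) with hc'def
  have hc'0 : 0 < c' := lt_max_of_lt_right (by norm_num)
  have hc'1 : c' < 1 := max_lt hc1 (by norm_num)
  have hcc' : c ≤ c' := le_max_left _ _
  have hlogc : Real.log c' < 0 := Real.log_neg hc'0 hc'1
  have hM₁0 : 0 ≤ M₁ := (abs_nonneg _).trans (hM₁ fun _ => 1)
  have hM₂0 : 0 ≤ M₂ := (abs_nonneg _).trans (hM₂ fun _ => 1)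
  have hN0 : (0 : ℝ) < N := by exact_mod_cast (show 0 < N by omega)
  have hE0 : 0 ≤ wilsonSmoothLip N d β := wilsonSmoothLip_nonneg hN d β
  -- the diameter of the two supports and the constant
  set D : ℕ := (Λ₁ ×ˢ Λ₂).sup fun ab => Literature.Probability.LatticeModels.Site.supNorm (ab.1.1 - ab.2.1)
    with hDdef
  set K' : ℝ := Real.exp (-(((D + 2 : ℕ) : ℝ) * Real.log c')) with hK'def
  have hK'0 : 0 < K' := Real.exp_pos _
  set J : ℝ := ((1 + 4 * (2 * (d - 1)) : ℕ) : ℝ) with hJdef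
  have hJ0 : 0 ≤ J := by rw [hJdef]; exact Nat.cast_nonneg _
  set E : ℝ := wilsonSmoothLip N d β
  refine ⟨2 * M₁ * M₂ * K' + 2 * (2 * Real.sqrt N) ^ 2 * ((Λ₂.card * J) * (M₂ * E)) *
    ((Λ₁.card * J) * (K' * (M₁ * E))), fun L _ hL x hx => ?_⟩
  have hL1 : 1 < L := by omega
  set μ := wilsonMeasure (d := d) (L := L) (fundamentalRep (Fin N)) β with hμdef
  haveI : IsProbabilityMeasure μ := by
    have hG : IsGibbsMeasure (torusWeightSpec (d := d) (L := L) (wilsonPlaqWeight N β)) μ := by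
      rw [hμdef, wilsonMeasure_eq_groupHeatKernelMeasure β]
      exact isGibbsMeasure_groupHeatKernelMeasure (continuous_wilsonPlaqWeight (N := N) β)
        (wilsonPlaqWeight_pos (N := N) β)
    exact hG.isProbabilityMeasure
  -- the observables on the torus of side `L`
  set f : GaugeConfig d L (Matrix.specialUnitaryGroup (Fin N) ℂ) → ℝ := toTorusObservable L F₁
  set g : GaugeConfig d L (Matrix.specialUnitaryGroup (Fin N) ℂ) → ℝ :=
    toTorusObservable L (F₂ ∘ QuantumLattice.configShift x)
  have hfm : Measurable f := h₁m.comp (measurable_torusLift L)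
  have hgm : Measurable g := (h₂m.comp (QuantumLattice.configShift x).measurable).comp (measurable_torusLift L)
  have hfdep := dependsOn_toTorusObservable (G := Matrix.specialUnitaryGroup (Fin N) ℂ) L hΛ₁
  have hgdep := dependsOn_toTorusObservable_configShift (G := Matrix.specialUnitaryGroup (Fin N) ℂ) L hΛ₂ x
  have hMf : ∀ σ, |f σ| ≤ M₁ := fun σ => hM₁ _
  have hMg : ∀ σ, |g σ| ≤ M₂ := fun σ => hM₂ _
  rw [show (∫ V, toTorusObservable L (fun U => F₁ U * F₂ (QuantumLattice.configShift x U)) V ∂μ) = ∫ V, f V * g V ∂μ from rfl]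
  set Δf : Finset (Edge d L) := Λ₁.image (torusEdge L)
  set Δg : Finset (Edge d L) := Λ₂.image fun e => torusEdge L (e.1 - x, e.2) with hΔg
  have hfdep' : DependsOn f (↑Δf : Set (Edge d L)) := hfdep
  have hgdep' : DependsOn g (↑Δg : Set (Edge d L)) := hgdep
  have hxL : 2 * Literature.Probability.LatticeModels.Site.supNorm x < L := by
    rw [Literature.Probability.LatticeModels.Site.norm_eq_supNorm] at hx
    exact_mod_cast hx
  have hexp : Real.exp (-krRate c * ‖x‖) =
      Real.exp ((Literature.Probability.LatticeModels.Site.supNorm x : ℝ) * Real.log c') := by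
    rw [Literature.Probability.LatticeModels.Site.norm_eq_supNorm, krRate, ← hc'def]
    congr 1
    ring
  rw [hexp]
  -- the trivial bound `|cov| ≤ 2 M₁ M₂`
  have htriv : |(∫ V, f V * g V ∂μ) - (∫ V, f V ∂μ) * ∫ V, g V ∂μ| ≤ 2 * M₁ * M₂ := by
    calc |(∫ V, f V * g V ∂μ) - (∫ V, f V ∂μ) * ∫ V, g V ∂μ|
        ≤ |∫ V, f V * g V ∂μ| + |(∫ V, f V ∂μ) * ∫ V, g V ∂μ| := abs_sub _ _
      _ ≤ M₁ * M₂ + M₁ * M₂ := by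
          refine add_le_add (abs_integral_le_of_abs_le (abs_mul_le_of_abs_le hMf hMg)) ?_
          rw [abs_mul]
          exact mul_le_mul (abs_integral_le_of_abs_le hMf) (abs_integral_le_of_abs_le hMg) (abs_nonneg _) hM₁0
      _ = 2 * M₁ * M₂ := by ring
  by_cases hnear : Literature.Probability.LatticeModels.Site.supNorm x < D + 2
  · -- NEAR: `K' e^{‖x‖ log c'} ≥ 1`
    have hone : 1 ≤ K' * Real.exp ((Literature.Probability.LatticeModels.Site.supNorm x : ℝ) * Real.log c') := by
      rw [hK'def, ← Real.exp_add]
      refine Real.one_le_exp ?_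
      have : ((Literature.Probability.LatticeModels.Site.supNorm x : ℕ) : ℝ) ≤ ((D + 2 : ℕ) : ℝ) := by
        exact_mod_cast hnear.le
      nlinarith
    refine htriv.trans ?_
    calc 2 * M₁ * M₂ ≤ 2 * M₁ * M₂ * (K' * Real.exp
          ((Literature.Probability.LatticeModels.Site.supNorm x : ℝ) * Real.log c')) :=
          le_mul_of_one_le_right (by positivity) hone
      _ ≤ (2 * M₁ * M₂ * K' + 2 * (2 * Real.sqrt N) ^ 2 * ((Λ₂.card * J) * (M₂ * E)) *
            ((Λ₁.card * J) * (K' * (M₁ * E)))) *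
            Real.exp ((Literature.Probability.LatticeModels.Site.supNorm x : ℝ) * Real.log c') := by
          rw [add_mul]
          refine le_add_of_le_of_nonneg (le_of_eq (by ring)) (by positivity)
  -- FAR: `D + 2 ≤ ‖x‖_∞`; the plaquette closure of `Δf` misses `Δg`
  rw [not_lt] at hnear
  have hsep : ∀ y ∈ plaqClosure Δf, y ∉ Δg := by
    intro y hy hyg
    obtain ⟨y₀, hy₀, hyy₀⟩ := exists_near_of_mem_plaqClosure hy
    obtain ⟨a, ha, rfl⟩ := Finset.mem_image.1 hy₀
    obtain ⟨b, hb, rfl⟩ := Finset.mem_image.1 hyg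
    have hs := supNorm_le_torusNorm_add (L := L) (a := a.1) (b := b.1) hxL
    have hDab : Literature.Probability.LatticeModels.Site.supNorm (a.1 - b.1) ≤ D := by
      rw [hDdef]
      exact Finset.le_sup (f := fun ab : ZdEdge d × ZdEdge d =>
        Literature.Probability.LatticeModels.Site.supNorm (ab.1.1 - ab.2.1)) (Finset.mk_mem_product ha hb)
    have h1 : torusNorm ((torusEdge L a).1 - (torusEdge L (b.1 - x, b.2)).1) ≤ 1 := by
      rw [← torusNorm_neg, neg_sub]; exact hyy₀
    have h2 : Literature.Probability.LatticeModels.Site.supNorm x ≤ 1 + D := hs.trans (Nat.add_le_add h1 hDab)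
    omega
  by_cases hΛ₂e : Λ₂ = ∅
  · -- `F₂` is constant on the torus: the covariance vanishes
    have hΔg0 : Δg = ∅ := by rw [hΔg, hΛ₂e, Finset.image_empty]
    set V₁ : GaugeConfig d L (Matrix.specialUnitaryGroup (Fin N) ℂ) := fun _ => 1
    have hgc : ∀ V, g V = g V₁ := fun V => hgdep' fun i hi => by simp [hΔg0] at hi
    have hI1 : ∫ V, f V * g V ∂μ = (∫ V, f V ∂μ) * g V₁ := by
      rw [← integral_mul_const]
      exact integral_congr_ae (ae_of_all _ fun V => by simp only [hgc V])
    have hI2 : ∫ V, g V ∂μ = g V₁ := by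
      have h := integral_congr_ae (μ := μ) (ae_of_all μ fun V => hgc V)
      rw [integral_const, smul_eq_mul, probReal_univ, one_mul] at h
      exact h
    have hI : (∫ V, f V * g V ∂μ) - (∫ V, f V ∂μ) * ∫ V, g V ∂μ = 0 := by rw [hI1, hI2, sub_self]
    rw [hI, abs_zero]
    positivity
  -- the distance profile to `plaqClosure Δg`
  have hΔgne : (plaqClosure Δg).Nonempty :=
    ((Finset.nonempty_iff_ne_empty.2 hΛ₂e).image _).mono (subset_plaqClosure Δg)
  obtain ⟨ℓ, hℓ0, hℓ1, hℓ2⟩ := exists_linkProfile (plaqClosure Δg) hΔgne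
  have hc'' : 6 * ((d : ℝ) - 1) * (|β| / N) * K ≤ c' := hc.trans hcc'
  have key := abs_integral_mul_sub_le_torusWilson hd hN hL1 hK hR hmod hc'' hc'1.le hfm hfdep' hMf hgm hgdep' hMg
    hsep ℓ hℓ0 (fun x' _ y hy => hℓ1 x' y hy)
  refine key.trans ?_
  -- `c' ^ ℓ y ≤ K' e^{‖x‖ log c'}` on `plaqClosure Δf`
  have hpow : ∀ y ∈ plaqClosure Δf, c' ^ ℓ y ≤
      K' * Real.exp ((Literature.Probability.LatticeModels.Site.supNorm x : ℝ) * Real.log c') := by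
    intro y hy
    obtain ⟨y₀, hy₀, hyy₀⟩ := exists_near_of_mem_plaqClosure hy
    obtain ⟨a, ha, rfl⟩ := Finset.mem_image.1 hy₀
    obtain ⟨z, hz, hzle⟩ := hℓ2 y
    obtain ⟨z₀, hz₀, hzz₀⟩ := exists_near_of_mem_plaqClosure hz
    obtain ⟨b, hb, rfl⟩ := Finset.mem_image.1 hz₀
    have hs := supNorm_le_torusNorm_add (L := L) (a := a.1) (b := b.1) hxL
    have hDab : Literature.Probability.LatticeModels.Site.supNorm (a.1 - b.1) ≤ D := by
      rw [hDdef]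
      exact Finset.le_sup (f := fun ab : ZdEdge d × ZdEdge d =>
        Literature.Probability.LatticeModels.Site.supNorm (ab.1.1 - ab.2.1)) (Finset.mk_mem_product ha hb)
    have htri : torusNorm ((torusEdge L a).1 - (torusEdge L (b.1 - x, b.2)).1) ≤ 1 + ℓ y + 1 := by
      calc torusNorm ((torusEdge L a).1 - (torusEdge L (b.1 - x, b.2)).1)
          ≤ torusNorm ((torusEdge L a).1 - y.1) + torusNorm (y.1 - (torusEdge L (b.1 - x, b.2)).1) :=
            torusNorm_sub_le _ _ _
        _ ≤ torusNorm ((torusEdge L a).1 - y.1) + (torusNorm (y.1 - z.1) + torusNorm (z.1 - (torusEdge L (b.1 - x, b.2)).1)) :=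
            Nat.add_le_add_left (torusNorm_sub_le _ _ _) _
        _ ≤ 1 + (ℓ y + 1) := by
            refine Nat.add_le_add ?_ (Nat.add_le_add hzle hzz₀)
            rw [← torusNorm_neg, neg_sub]; exact hyy₀
        _ = 1 + ℓ y + 1 := by ring
    have hineq : (Literature.Probability.LatticeModels.Site.supNorm x : ℝ) ≤ ℓ y + ((D + 2 : ℕ) : ℝ) := by
      have : Literature.Probability.LatticeModels.Site.supNorm x ≤ ℓ y + (D + 2) := by
        have := hs.trans (Nat.add_le_add htri hDab); omega
      exact_mod_cast this
    rw [hK'def, ← Real.exp_add, ← Real.exp_log hc'0, ← Real.exp_nat_mul, Real.exp_log hc'0]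
    refine Real.exp_le_exp.2 ?_
    nlinarith
  have hsumf : ∑ y ∈ plaqClosure Δf, c' ^ ℓ y * (M₁ * E) ≤
      (Λ₁.card * J) * (K' * Real.exp ((Literature.Probability.LatticeModels.Site.supNorm x : ℝ) * Real.log c') *
        (M₁ * E)) := by
    calc ∑ y ∈ plaqClosure Δf, c' ^ ℓ y * (M₁ * E)
        ≤ ∑ _y ∈ plaqClosure Δf, K' * Real.exp ((Literature.Probability.LatticeModels.Site.supNorm x : ℝ) *
            Real.log c') * (M₁ * E) :=
          Finset.sum_le_sum fun y hy => mul_le_mul_of_nonneg_right (hpow y hy) (by positivity)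
      _ = (plaqClosure Δf).card * (K' * Real.exp ((Literature.Probability.LatticeModels.Site.supNorm x : ℝ) *
            Real.log c') * (M₁ * E)) := by rw [Finset.sum_const, nsmul_eq_mul]
      _ ≤ (Λ₁.card * J) * (K' * Real.exp ((Literature.Probability.LatticeModels.Site.supNorm x : ℝ) *
            Real.log c') * (M₁ * E)) := by
          refine mul_le_mul_of_nonneg_right ?_ (by positivity)
          have h1 : ((plaqClosure Δf).card : ℝ) ≤ Δf.card * J := by
            rw [hJdef]; exact_mod_cast card_plaqClosure_le Δf
          have h2 : (Δf.card : ℝ) ≤ Λ₁.card := by exact_mod_cast Finset.card_image_le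
          exact h1.trans (mul_le_mul_of_nonneg_right h2 hJ0)
  have hsumg : ∑ _y ∈ plaqClosure Δg, M₂ * E ≤ (Λ₂.card * J) * (M₂ * E) := by
    rw [Finset.sum_const, nsmul_eq_mul]
    refine mul_le_mul_of_nonneg_right ?_ (by positivity)
    have h1 : ((plaqClosure Δg).card : ℝ) ≤ Δg.card * J := by
      rw [hJdef]; exact_mod_cast card_plaqClosure_le Δg
    have h2 : (Δg.card : ℝ) ≤ Λ₂.card := by exact_mod_cast Finset.card_image_le
    exact h1.trans (mul_le_mul_of_nonneg_right h2 hJ0)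
  have hsumg0 : 0 ≤ ∑ _y ∈ plaqClosure Δg, M₂ * E := Finset.sum_nonneg fun _ _ => by positivity
  calc 2 * (2 * Real.sqrt N) ^ 2 * (∑ _y ∈ plaqClosure Δg, M₂ * E) * ∑ y ∈ plaqClosure Δf, c' ^ ℓ y * (M₁ * E)
      ≤ 2 * (2 * Real.sqrt N) ^ 2 * ((Λ₂.card * J) * (M₂ * E)) * ((Λ₁.card * J) * (K' * Real.exp
          ((Literature.Probability.LatticeModels.Site.supNorm x : ℝ) * Real.log c') * (M₁ * E))) := by
        exact mul_le_mul (mul_le_mul_of_nonneg_left hsumg (by positivity)) hsumf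
          (Finset.sum_nonneg fun _ _ => by positivity) (by positivity)
    _ = 2 * (2 * Real.sqrt N) ^ 2 * ((Λ₂.card * J) * (M₂ * E)) * ((Λ₁.card * J) * (K' * (M₁ * E))) *
          Real.exp ((Literature.Probability.LatticeModels.Site.supNorm x : ℝ) * Real.log c') := by ring
    _ ≤ (2 * M₁ * M₂ * K' + 2 * (2 * Real.sqrt N) ^ 2 * ((Λ₂.card * J) * (M₂ * E)) *
          ((Λ₁.card * J) * (K' * (M₁ * E)))) *
          Real.exp ((Literature.Probability.LatticeModels.Site.supNorm x : ℝ) * Real.log c') := by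
        rw [add_mul]
        exact le_add_of_nonneg_left (by positivity)

end Clustering

/-! ## §8 The strong-coupling front of the crossover ledger, instantiated -/

section Front

variable {N : ℕ}

/-- `‖−n e₀‖_∞ = n` for the Euclidean-time displacement. [folklore] -/
theorem norm_neg_single_natCast (n : ℕ) :
    ‖(-Pi.single (0 : Fin 4) (n : ℤ) : Literature.Probability.LatticeModels.Site 4)‖ = n := by
  rw [norm_neg, Pi.norm_single, Int.norm_natCast]

/-- **`ExponentialClustering` of the crossover ledger from the one-link modulus** (`d = 4`): if `(|β|/N)·6 ≤ R`,
`OneLinkKRModulus N R K` and `18 (|β|/N) K ≤ c < 1`, then `ExponentialClustering (fundamentalRep (Fin N)) β (krRate c)` —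
for every pair of species ONE constant on all tori `(ℤ/(2S+1))⁴`, `S ≥ 1`, all time separations `n ≤ S` (translation
invariance of the torus state, `wilsonMeasure_map_torusConfigShift`, identifies `⟨B ∘ θ⟩ = ⟨B⟩`).
[cite: arXiv220412737, unnumbered remark p. 6 (after Rem. 1.3; Dobrushin route) with Thm. 1.2 (Uniqueness and ergodicity) and Cor. 1.6 (Mass gap)]
[cite: Follmer1988, Ch. I Theorem (2.13)] -/
theorem exponentialClustering_of_oneLinkKRModulus (hN : 1 ≤ N) {β R K c : ℝ} (hK : 0 ≤ K)
    (hR : |β| / N * 6 ≤ R) (hmod : OneLinkKRModulus N R K) (hc : 18 * (|β| / N) * K ≤ c) (hc1 : c < 1) :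
    CrossoverLedger.ExponentialClustering (G := Matrix.specialUnitaryGroup (Fin N) ℂ) (fundamentalRep (Fin N)) β
      (krRate c) := by
  refine ⟨krRate_pos hc1, fun A B => ?_⟩
  have hR' : |β| / N * (2 * (((4 : ℕ) : ℝ) - 1)) ≤ R := by norm_num; linarith
  have hc' : 6 * (((4 : ℕ) : ℝ) - 1) * (|β| / N) * K ≤ c := by norm_num; linarith
  obtain ⟨C, hC⟩ := wilson_torusClustering_of_oneLinkKRModulus (d := 4) (by norm_num) hN hK hR' hmod hc' hc1
    A.F B.F ⟨A.supp, A.isCylinder⟩ ⟨B.supp, B.isCylinder⟩ A.measurable B.measurable A.bounded B.bounded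
  refine ⟨C, 1, fun S hS n hn => ?_⟩
  have hL2 : 2 ≤ 2 * S + 1 := by omega
  set x : Literature.Probability.LatticeModels.Site 4 := -Pi.single (0 : Fin 4) (n : ℤ)
  have hxn : ‖x‖ = n := norm_neg_single_natCast n
  have hx2 : 2 * ‖x‖ < ((2 * S + 1 : ℕ) : ℝ) := by
    rw [hxn]; push_cast
    have : (n : ℝ) ≤ S := by exact_mod_cast hn
    linarith
  have h := hC (2 * S + 1) hL2 x hx2
  rw [hxn, neg_mul] at h
  -- translation invariance: `⟨B ∘ θ_x⟩ = ⟨B⟩`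
  have htrans : ∫ V, toTorusObservable (2 * S + 1) (B.F ∘ QuantumLattice.configShift x) V
      ∂(wilsonMeasure (d := 4) (L := 2 * S + 1) (fundamentalRep (Fin N)) β) =
      ∫ V, toTorusObservable (2 * S + 1) B.F V ∂(wilsonMeasure (d := 4) (L := 2 * S + 1) (fundamentalRep (Fin N)) β) := by
    rw [toTorusObservable_comp_configShift]
    simp only [Function.comp_apply]
    rw [← integral_map_equiv, wilsonMeasure_map_torusConfigShift]
  rw [htrans] at h
  exact h

/-- **The strong-coupling front from the one-link modulus** (general `N`, `d = 4`): for `(β₀/N)·6 ≤ R`,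
`OneLinkKRModulus N R K` and `18 (β₀/N) K < 1`, the front `StrongCouplingFront (fundamentalLatticeRep N) β₀` of the
crossover ledger holds with the single rate `m = −log max(18 (β₀/N) K, 1/2)` for every `0 ≤ β ≤ β₀` (the radius and the
Dobrushin constant are monotone in `β`).  Every hypothesis explicit; the modulus is decided off kernel by certificate.
[cite: arXiv220412737, unnumbered remark p. 6 (after Rem. 1.3; Dobrushin route) with Thm. 1.2 (Uniqueness and ergodicity) and Cor. 1.6 (Mass gap)] -/
theorem strongCouplingFront_of_oneLinkKRModulus (hN : 1 ≤ N) {β₀ R K : ℝ} (hK : 0 ≤ K)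
    (hR : β₀ / N * 6 ≤ R) (hmod : OneLinkKRModulus N R K) (hsmall : 18 * (β₀ / N) * K < 1) :
    CrossoverLedger.StrongCouplingFront (fundamentalLatticeRep N) β₀ := by
  have hN0 : (0 : ℝ) < N := by exact_mod_cast (show 0 < N by omega)
  refine ⟨krRate (18 * (β₀ / N) * K), krRate_pos hsmall, fun β hβ0 hββ₀ => ?_⟩
  have hβabs : |β| = β := abs_of_nonneg hβ0
  have hdiv : |β| / N ≤ β₀ / N := by rw [hβabs]; exact div_le_div_of_nonneg_right hββ₀ hN0.le
  refine exponentialClustering_of_oneLinkKRModulus hN hK ?_ hmod ?_ hsmall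
  · exact (mul_le_mul_of_nonneg_right hdiv (by norm_num)).trans hR
  · exact mul_le_mul_of_nonneg_right (mul_le_mul_of_nonneg_left hdiv (by norm_num)) hK

/-- **J-SC3 window ⇒ the `SU(2)` strong-coupling front** (Wilson units): `OneLinkKRModulusSU2 β₀W K₂` with `18 β₀W K₂ < 1`
gives `StrongCouplingFront (fundamentalLatticeRep 2) (β₀W/2)` — the front stands at tree coupling `β₀W/2`
(`= 2 · (β₀W/4)`, 't Hooft `β₀W/4`, Wilson `β₀W`).  This instantiates the FIRST hypothesis of
`CrossoverLedger.massGap_of_frontsMeet` for `SU(2)`; the certificate deciding the modulus lives off kernel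
(`ir/FRONT-SC.md` §3b) and is never asserted here. [cite: arXiv220412737, unnumbered remark p. 6 (after Rem. 1.3; Dobrushin route) with Thm. 1.2 (Uniqueness and ergodicity) and Cor. 1.6 (Mass gap)] -/
theorem su2_strongCouplingFront_of_oneLinkKRModulus {β₀W K₂ : ℝ} (hK : 0 ≤ K₂)
    (hmod : OneLinkKRModulusSU2 β₀W K₂) (hsmall : 18 * β₀W * K₂ < 1) :
    CrossoverLedger.StrongCouplingFront (fundamentalLatticeRep 2) (β₀W / 2) := by
  refine strongCouplingFront_of_oneLinkKRModulus (N := 2) (by norm_num) (K := 4 * K₂) (by positivity)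
    (R := 3 * β₀W / 2) (le_of_eq (by push_cast; ring)) hmod ?_
  convert hsmall using 1
  push_cast
  ring

/-- **Shen–Zhu–Zhu's printed window as a front, through the kernel** (`SU(2)`): under the one-link Poincaré hypothesis `hLP`
of `oneLinkKRModulus_of_haarPoincare` (the Bakry–Émery bound, Shen–Zhu–Zhu Lemma 4.1 / (4.4) at one link), every
`β₀W < 1/12` (Wilson units; `= 1/(16(d−1))` in 't Hooft units `β₀W/4`, Assumption 1.1) gives
`StrongCouplingFront (fundamentalLatticeRep 2) (β₀W/2)`.  Nothing beyond S16's window is claimed. [cite: arXiv220412737, Assumption 1.1, Thm. 1.2 (Uniqueness and ergodicity), Lemma 4.1, Cor. 1.6 (Mass gap)] -/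
theorem su2_strongCouplingFront_of_haarPoincare
    (hLP : ∀ B : Matrix (Fin 2) (Fin 2) ℂ, matrixOpNorm B < 1 / 2 →
      ∀ (ψ : Matrix.specialUnitaryGroup (Fin 2) ℂ → ℝ) (M : ℝ), 0 ≤ M →
        (∀ a b, |ψ a - ψ b| ≤ M * suFrobDist a b) →
        Var[ψ; (haarProbability (Matrix.specialUnitaryGroup (Fin 2) ℂ)).tilted
            fun g => ((2 : ℕ) : ℝ) * ((g : Matrix (Fin 2) (Fin 2) ℂ) * B).trace.re] ≤
          M ^ 2 / (((2 : ℕ) : ℝ) * (1 / 2 - matrixOpNorm B)))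
    {β₀W : ℝ} (hβ : β₀W < 1 / 12) :
    CrossoverLedger.StrongCouplingFront (fundamentalLatticeRep 2) (β₀W / 2) := by
  have hRlt : 3 * β₀W / 2 < 1 / 2 := by linarith
  have hK0 : (0 : ℝ) < 1 / 2 - 3 * β₀W / 2 := by linarith
  have hmod := oneLinkKRModulus_of_haarPoincare (N := 2) (by norm_num) hLP hRlt
  refine strongCouplingFront_of_oneLinkKRModulus (N := 2) (by norm_num) (K := 1 / (1 / 2 - 3 * β₀W / 2))
    (by positivity) (R := 3 * β₀W / 2) (le_of_eq (by push_cast; ring)) hmod ?_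
  -- `18 (β₀W/4) / (1/2 − 3β₀W/2) < 1 ⟺ 12 β₀W < 1`
  have key : 9 * β₀W / 2 / (1 / 2 - 3 * β₀W / 2) < 1 := by rw [div_lt_one hK0]; linarith
  convert key using 1
  push_cast
  ring

end Front
end Literature.MathematicalPhysics.QuantumFieldTheory.Balaban1983to89.StrongCouplingTorusWindow
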